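import Mathlib
import HarnessLib
import Summits.NavierStokesRegularity.NavierStokesRegularity.Theses.PoloidalWindowDoor
import Summits.NavierStokesRegularity.NavierStokesRegularity.Theorems.PoloidalWindowDoorPoloidalWindowRigiditySharper
import Summits.NavierStokesRegularity.NavierStokesRegularity.Theorems.PoloidalWindowDoorPoloidalWindowRigidityFlat
import Summits.NavierStokesRegularity.NavierStokesRegularity.Theorems.PoloidalWindowDoorLrcModEntireIff
import Summits.NavierStokesRegularity.NavierStokesRegularity.Theorems.PoloidalWindowDoorLrcModEntireUntwistedGerm
import Summits.NavierStokesRegularity.NavierStokesRegularity.Theorems.PoloidalWindowDoorLrcModEntireTwistingTHLocalHypGerm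
import Summits.NavierStokesRegularity.NavierStokesRegularity.Theorems.PoloidalWindowDoorLrcModEntireTwistingTHLocalNonUmbilic
import Summits.NavierStokesRegularity.NavierStokesRegularity.Theorems.PoloidalWindowDoorLrcModEntireTwistingTHLocalGalilean
import Summits.NavierStokesRegularity.NavierStokesRegularity.Theorems.PoloidalWindowDoorLrcModEntireTwistingTHLocalNormalFormRS
import Summits.NavierStokesRegularity.NavierStokesRegularity.Theorems.PoloidalWindowDoorPoloidalWindowRigidityTimeShearClosed
import Summits.NavierStokesRegularity.NavierStokesRegularity.Theorems.PoloidalWindowDoorPoloidalWindowRigiditySymmetryGerms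
import Summits.NavierStokesRegularity.NavierStokesRegularity.Theorems.PoloidalWindowDoorPoloidalWindowRigidityVerticalShearGerm
import Summits.NavierStokesRegularity.NavierStokesRegularity.Theorems.LocalSineTubeDoorProfileAlignedWindowRigidityAncient
import Summits.NavierStokesRegularity.NavierStokesRegularity.Theorems.LoopPeriodRatchetPeriodScalingBound
import Summits.NavierStokesRegularity.NavierStokesRegularity.Theorems.LoopPeriodRatchetNoPlanarExtremumOrbit
import Summits.NavierStokesRegularity.NavierStokesRegularity.Theorems.PoloidalWindowDoorPoloidalWindowRigidityClebsch
import Summits.NavierStokesRegularity.NavierStokesRegularity.Theorems.PoloidalWindowDoorPoloidalWindowRigidityFirstIntegral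
import Summits.NavierStokesRegularity.NavierStokesRegularity.Theorems.PoloidalWindowDoorLrcModEntireLevelSlaving
import Summits.NavierStokesRegularity.NavierStokesRegularity.Theorems.PoloidalWindowDoorLrcModEntireMorseLevelPackage
import Literature.Analysis.FluidPDE.VorticityCalculus

/-!
# SKELETON `thread_axis` v10.1 — crux `PoloidalWindowRigidity` (K2, stmt-NavierStokesRegularity-19708; closes ALSO the promoted stub
# `LrcModEntire`, stmt-NavierStokesRegularity-20428), route `PoloidalWindowDoor` — ideator seat ns-idea-8 gen 2, LINE 5 (v10: gen 3).
# v10.2 (2026-08-28T13:55Z): S7′-M is no longer a stub — LANDED p636479 `…Theorems.PoloidalWindowDoorLrcModEntireMorseLevelPackage.stub_morseLevelPackage`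
# (K2-p3 lineage), cited BY NAME as `morseLevelPackage_landed`; sorries 6 → 5 = {S0 `stub_localTHEmptyHypNUGRS` (shared R-TH), S3′ `stub_threadedThickEmptyFlat`,
# S4 `stub_threadDichotomy`, `stub_extremalThread`, S6G `stub_frequencyGrowthExponent` = 27893 (deciding, shared by name with LoopPeriodRatchet rev 2)}.
# v10 (2026-08-28T12:50Z, ns-idea-8 g3; plan ENDORSED by idea-crit-7 10:40:41Z): S7′-S IS NO LONGER A STUB.  S7′-M `stub_morseLevelPackage` (v10.2: LANDED p636479 as `…Theorems.PoloidalWindowDoorLrcModEntireMorseLevelPackage.stub_morseLevelPackage`, cited BY NAME as `morseLevelPackage_landed`)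
# now delivers a differentiable horizontal COVERING CURVE `σ` of the level circle (`HasDerivAt σ (σ' θ) θ`, `σ' θ 2 = 0`, `dg(σ') = 0`,
# `H ∘ σ = 0`, `{H = 0} ⊆ range σ`) instead of `IsConnected {H = 0}` (the radial-graph parametrisation of a near-top level circle of the
# horizontally concave `g(·,p₂)`); S7′-S is the THEOREM `slavedOnLevelCircle`, proved from the LANDED sorry-free curve-form slave lemma
# `Theorems.PoloidalWindowDoorLrcModEntireLevelSlaving.slaved_along_curve` (p632923, relayed by LEAD ns-poloidal-K2-p3 from the companion
# workfile `Lines/thread_axis_slave.lean`, tree 2f7155f155c1; v10 inlined it, v10.1 imports the Theorems module and cites it by name).  SORRIES 7 → 6 = {`stub_localTHEmptyHypNUGRS` (shared), `stub_extremalThread` S1, `stub_threadDichotomy` S2,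
# `stub_threadedThickEmptyFlat` S3′, `stub_frequencyGrowthExponent` S6G (deciding; ≤ `LoopPeriodRatchet.PeriodRatchet`), `morseLevelPackage_landed`
# S7′-M (pure calculus, M/L)}.  Everything else below is v9 text.  No summit, crux or typed item is proved; 19708 / 20428 / 22492 OPEN.
# v9 (critic idea-crit-7 09:53:50Z ARCH price PAID): the pure-analysis S7′ `planarFirstIntegralGerm` is now itself a THEOREM, composed
# (kernel-checked) from THREE NAMED PIECES — S7′-M `morseLevelPackage_landed` (parametrised Morse tube + cut-off: pure calculus on the
# scalar first integral), S7′-S `stub_slavedOnLevelCircle` (the stream function is slaved to the first integral along a connected regular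
# level circle: `∇ₕψ = λ ∇ₕV₂`, λ constant — Lie-bracket rigidity), and S7′-orbit = the TREE's PROVED
# `LoopPeriodRatchetNoPlanarExtremumOrbit.exists_periodic_orbit_of_regular_level` (a non-vanishing tangent field on a bounded regular level
# set of `H : ℝ³ → ℝ²` carries a periodic orbit through every point) — the ONLY dynamical content, cited not re-stubbed.
# v8: S7 `threadGermOfNPV` is now a THEOREM — its whole fluid layer (smooth slice, Clebsch potentials, the PROVED frozen constraint
# `stub_firstIntegral`, bracket form) is composed from the tree, leaving the PURE PLANAR-DYNAMICS statement S7′ (v8 stub `stub_planarFirstIntegralGerm`; v9 theorem `planarFirstIntegralGerm`)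
# (a first integral with a Morse extremum + no periodic orbits ⇒ the commuting Hamiltonian field vanishes near the extremum; M/L,
# Khovanskii-type, same toolkit as the tree's `LoopPeriodRatchetNoPlanarExtremum*`).
# v7 (CROSS-ROUTE, found 09:15Z by `rg Yorke` over Theses/): the ENGINE CARRIER of this line — the orbital frequency 1/T of closed vortex lines, the
# Yorke × Type-I period floor and the scaling contradiction — is ALSO the lever of route `LoopPeriodRatchet` (ideator ns-idea-1 g0; items
# PeriodRatchet (open, XL), PeriodScalingBound (PROVED), NoLoopsOfRatchet (PROVED), OpenLoopLiouville split into NoPlanarExtremum (PROVED) +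
# PlanarExtremumLiouville (open)).  Consequences drawn here: S6Y `periodFloorYorke` is now a COROLLARY of the tree theorem
# `periodScalingBound_proof` (v6's smoothing stub S6L and own weak Yorke bound are superseded; kept in the rung file only); the new sorry-free
# CERTIFICATE `frequencyGrowthExponent_of_periodRatchet : PeriodRatchet → S6G` records that this line's deciding stub S6G (growth exponent
# κ < 3/2) is a WEAKENING of their deciding crux (monotone ratchet, κ = 0); what is this line's own: the closed-form frequency law + twist
# residue (I8a/I8b: the pointwise ratchet fails off symmetry at first order for general poloidal data — an instrument row for THEIR kill
# criterion), the exponent form, and the downstream thread normal-form chain (S1/S2/S7/S3′/S0) in place of their PlanarExtremumLiouville.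
# v6: S6Y was proved from an own weak Yorke bound + a smoothing stub (superseded by v7).  v5 (answers critic idea-crit-7 08:51:36Z P1′ «type the theorem the engine CAN prove»): S6
# `noPeriodicVortexLine` is a THEOREM, proved by the sorry-free pure-real-analysis ENGINE THEOREM `noOrbit_of_floor_and_growth` from S6Y (then
# `stub_periodFloorYorke`: Yorke 1969 × Type-I smoothing ⇒ period ≥ c₀(−t)^{3/2}) and S6G `stub_frequencyGrowthExponent` (RESEARCH, deciding = THE WALL typed: backward frequency growth
# exponent κ < 3/2, = (Z1)+(Z3)+[sup(−t)(Θ²δ″+R_z) ≤ κ′ < 3/2]); `push_neg` lint fixed.  v3 (answers P1 «name the ZERO-FORCING input»): the former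
# deciding stub `stub_threadAxis` is the THEOREM `threadAxis_of_NPV`, from S6 (then `stub_noPeriodicVortexLine`, RESEARCH: a poloidal class profile has NO periodic
# vortex line — the non-symmetric KNSS 5.2; Θ := 2π / (period of the vortex line) = the orbital FREQUENCY of the planar Hamiltonian field
# ω(t,·,z) = ∇ₕF × e₃ is KNSS's ω_θ/r; zero-forcing = period blow-up at the edge of every period annulus + Yorke's bound T ≥ 2π/Lip ω(t) with
# Type-I decay + the weak maximum principle for bounded solutions on the non-cylindrical space-time tube; the ONE wall is the max-principle FORM of
# Θ's law off symmetry (twist), card §P1) and S7 `stub_threadGermOfNPV` (PROVABLE, L: Morse hot spot + frozen constraint ω·∇v₂ = 0 ⇒ the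
# v₂-level circles are vortex lines, F is leafwise constant, so «no periodic vortex line» ⇒ ω ≡ 0 on the punctured Morse disc).  v2 = v1 + the
# signed pins `threadSignedPin` (S5: PROVED in v4, sorry-free; was `stub_threadSignedPin`, shared with far_thread).  RUNG (sorry-free, separate file `Lines/thread_axis_rung.lean`):
# the axisymmetric swirl-free case of S6/S7's conclusion from the named fact `KNSS2009_liouville_axisymmetric_no_swirl`.
# `LrcModEntire`, stmt-NavierStokesRegularity-20428), route `PoloidalWindowDoor` — ideator seat ns-idea-8 gen 2, LINE 5
# (lens «barrier», sub-lens TRANSFER: the solved sibling is KNSS 2009 Thm 5.2, axisymmetric no swirl; files-only per KEY-NS #68/#69).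

LEVER (five words): **the thread is the axis.**  Axisymmetric swirl-free fields ARE poloidal along `e₃` (`ω = ω_θ e_θ ⊥ e₃`), their symmetry
axis is a line of THREADS (`∇ₕv₂ = 0 ≠ v₂`), and KNSS's Liouville proof runs on ONE scalar, `Θ = ω_θ / r`, which solves a drift–diffusion equation
with no zeroth-order term (`Θ_t + b·∇Θ = Δ₅Θ`).  For a general poloidal field write `v = ∇φ + F e₃` (possible iff `ω·e₃ ≡ 0`; then
`ω = ∇F × e₃`, `div v = 0 ⇔ Δφ = −F_z`); the horizontal momentum equation is exactly `∇ₕΠ = v₂ ∇ₕF` for the head `Π := p + φ_t + |v|²/2 + F_z`,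
the frozen law is `{v₂, F}ₕ = 0`, and the WHOLE vorticity equation is the scalar equation `(∂ₜ + v·∇ − Δ)F = −(∂_zΠ)|_F` plus
`∇ₕ[(∂ₜ + v·∇ − Δ)|∇ₕF|…]`: the horizontal vorticity `g = ∇ₕF` obeys `(∂ₜ + v·∇ − Δ)g = cof(D²ₕφ)·g` (stretching rate along a leaf = `φ_ττ`).
In axisymmetry `Θ = −∂F/∂(r²/2)` = the derivative of the flux function `F` with respect to the AREA enclosed by the (circular) leaf, and the
identity `∂_FQ = −(∂_z v₂)|_F` for the source is exactly what makes `Θ`'s equation source-free (checked by hand, card §Transfer).  So at a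
MORSE thread of a hot-spot-normalised profile (free: `far_thread`'s `stub_extremalThread` + `threadPin_of_hotSpot`, shared verbatim), where the
leaves are closed curves around a thread CURVE `γ(t,z)` (implicit function theorem), the area-derivative `Θ := ∂F/∂𝒜` is defined on the
closed-leaf tube and the sibling's proof can be PORTED STEP BY STEP; the first non-transferring step — the Eulerian weight (`r` is geometric only by
symmetry; in general `Θ`'s equation acquires a defect measuring the non-roundness / twist of the leaves) — is the research content of the deciding
theorem `threadAxis_of_NPV` (v3; from S6 + S7): a Morse hot spot is an IRROTATIONAL GERM.  The tree then closes (`eq_zero_of_curl_eq_zero_on_open` ⇒ `v ≡ 0`, absurd).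
No window taxonomy (untwisted / (TV) / (TH) / THICK) is needed on the Morse branch: the axis calculus is blind to the slope structure.

RESIDUE: a NON-MORSE hot spot (the horizontal Hessian of `v₂(−1,·)` at `0` has a null direction).  There the line falls back on `far_thread`'s
point dichotomy (`stub_threadDichotomy`, shared verbatim) with every non-thick branch a TREE theorem in Liouville currency and the (TH) branch the
SHARED registered local stub (`stub_localTHEmptyHypNUGRS`, twist_split v4.3); the thick branch is `far_thread`'s deciding stub WEAKENED by the
non-Morse hypothesis (`stub_threadedThickEmptyFlat`) — so this line also SHRINKS `far_thread`'s research stub to flat hot spots.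

COMPOSITION (kernel-checked, no sorry outside `stub_*`): `poloidalLiouville_of_threadAxis` (class + poloidal ⇒ `v ≡ 0`) ⇒
`PoloidalWindowRigidity_of_threadAxis : …Theses.PoloidalWindowDoor.PoloidalWindowRigidity` and `LrcModEntire_of_threadAxis : …LrcModEntire`.

WHAT THIS IS NOT: not a proof of Navier–Stokes regularity, of K2, or of KNSS-transfer — a typed line with ONE deciding research stub (v5–v7: `stub_frequencyGrowthExponent`, S6G = the wall typed, a certified weakening of `LoopPeriodRatchet.PeriodRatchet`; S6 itself is proved from S6Y + S6G, and S6Y (v7) is a corollary of the tree's `periodScalingBound_proof`; plus the provable PURE-ANALYSIS piece S7′-M `morseLevelPackage_landed` (v10: S7′-S `slavedOnLevelCircle` is PROVED in curve form; S7′ `planarFirstIntegralGerm` is a theorem from them and the tree's orbit lemma, S7 `threadGermOfNPV` a theorem from S7′ and the tree's Clebsch/frozen-constraint lemmas)),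
one weakened research residue (`stub_threadedThickEmptyFlat` ⊂ far_thread's S3), two provable normal-form stubs and one shared registered stub;
(M) and the Type-I class are kept in every class-level stub (honours `Negative.poloidalWindowRigidity_false_without_mild`, K-47, K-50).
bears_on LADDER-NS N0 (rung N0-LocalTubeDoorPoloidal), items 19708 / 20428.  Sibling fact in the tree: `Literature.Analysis.FluidPDE.KNSS2009_liouville_axisymmetric_no_swirl`
(named), `knss2009_axisymmetric_no_swirl_of_KNSS2009`, `KNSS2009_liouville_bound_C_over_r_of_harnack` (Thm 5.2 from the Harnack inequality).
-/

noncomputable section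

set_option linter.dupNamespace false
set_option linter.unusedVariables false

/-! ## S7′-S in CURVE form — the slave lemma is CITED FROM THE TREE (v10.1).
The sorry-free curve-form slave lemma (ns-idea-8 g2 workfile `Lines/thread_axis_slave.lean`, tree 2f7155f155c1) was LANDED in Theorems by the
20428 LEAD ns-poloidal-K2-p3 g10 as `Theorems/PoloidalWindowDoorLrcModEntireLevelSlaving.lean` (p632923, 2026-08-28T12:20:46Z, relay with author credit;
`--supports 20428 --as helper`): `Summit.NavierStokesRegularity.NavierStokesRegularity.Theorems.PoloidalWindowDoorLrcModEntireLevelSlaving.slaved_along_curve`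
(identical signature).  v10 inlined the text; v10.1 imports the landed module and cites the theorem by name (no restatement). -/

namespace Summit.NavierStokesRegularity.NavierStokesRegularity.Cruxes.PoloidalWindowRigidity.ThreadAxis

open MeasureTheory Set Function Filter Topology Metric
open scoped RealInnerProductSpace InnerProductSpace Laplacian
open Literature.Analysis Literature.Analysis.FluidPDE
open Summit.NavierStokesRegularity.NavierStokesRegularity.Theses.PoloidalWindowDoor
open Summit.NavierStokesRegularity.NavierStokesRegularity.Theorems.LocalSineTubeDoorProfileAlignedWindowRigidityAncient
open Summit.NavierStokesRegularity.NavierStokesRegularity.Theorems.PoloidalWindowDoorPoloidalWindowRigiditySharper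
open Summit.NavierStokesRegularity.NavierStokesRegularity.Theorems.PoloidalWindowDoorPoloidalWindowRigidityFlat
open Summit.NavierStokesRegularity.NavierStokesRegularity.Theorems.PoloidalWindowDoorLrcModEntireIff
open Summit.NavierStokesRegularity.NavierStokesRegularity.Theorems.PoloidalWindowDoorLrcModEntireUntwistedGerm
open Summit.NavierStokesRegularity.NavierStokesRegularity.Theorems.PoloidalWindowDoorLrcModEntireTwistingTHLocalHypGerm
open Summit.NavierStokesRegularity.NavierStokesRegularity.Theorems.PoloidalWindowDoorLrcModEntireTwistingTHLocalNonUmbilic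
open Summit.NavierStokesRegularity.NavierStokesRegularity.Theorems.PoloidalWindowDoorLrcModEntireTwistingTHLocalGalilean
open Summit.NavierStokesRegularity.NavierStokesRegularity.Theorems.PoloidalWindowDoorLrcModEntireTwistingTHLocalNormalFormRS
open Summit.NavierStokesRegularity.NavierStokesRegularity.Theorems.PoloidalWindowDoorPoloidalWindowRigidityTimeShearPressure
open Summit.NavierStokesRegularity.NavierStokesRegularity.Theorems.PoloidalWindowDoorPoloidalWindowRigidityTimeShearLiminf
open Summit.NavierStokesRegularity.NavierStokesRegularity.Theorems.PoloidalWindowDoorPoloidalWindowRigidityHorizontalFlatPast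
open Summit.NavierStokesRegularity.NavierStokesRegularity.Theorems.PoloidalWindowDoorPoloidalWindowRigiditySymmetryGerms
open Summit.NavierStokesRegularity.NavierStokesRegularity.Theorems.PoloidalWindowDoorPoloidalWindowRigidityVerticalShearGerm
open Summit.NavierStokesRegularity.NavierStokesRegularity.Theorems.LocalSineTubeDoorProfileAlignedWindowRigidityAncient

/-! ## The stubs -/

/-- **SHARED STUB ((TH) column) — VERBATIM `stub_localTHEmptyHypNUGRS` of the skeleton of record `Cruxes/LrcModEntire/Lines/twist_split.lean`
v4.3 (ns-poloidal-K2-p3 g9; item stmt-NavierStokesRegularity-20428).**  The local hyperbolic (TH)∩twisting PDE system is empty at a non-umbilic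
rest point in the rotation/scaling gauge.  One landing closes it here and there.  (This line needs the (TH) column in LIOUVILLE currency — the
recentred profile is not known to be singular — which is exactly what the local statement gives through
`…TwistingTHLocalHypGerm.stub_twistingTH_of_localEmptyHyp` + `…LrcModEntireIff.eq_zero_of_germ`.) -/
theorem stub_localTHEmptyHypNUGRS :
    ∀ (u : ℝ → EuclideanSpace ℝ (Fin 3) → EuclideanSpace ℝ (Fin 3)) (μ A : ℝ → ℝ → ℝ)
      (U : Set (ℝ × EuclideanSpace ℝ (Fin 3))) (p₀ : ℝ × EuclideanSpace ℝ (Fin 3)),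
      IsOpen U → p₀ ∈ U →
      AnalyticOnNhd ℝ (Function.uncurry u) U →
      (∀ p ∈ U, AnalyticAt ℝ (Function.uncurry μ) (p.1, p.2 2)) →
      (∀ p ∈ U, AnalyticAt ℝ (Function.uncurry A) (p.1, p.2 2)) →
      (∀ p ∈ U, fderiv ℝ (u p.1) p.2 (EuclideanSpace.single 0 1) 1 = fderiv ℝ (u p.1) p.2 (EuclideanSpace.single 1 1) 0) →
      (∀ p ∈ U, fderiv ℝ (u p.1) p.2 (EuclideanSpace.single 0 1) 0 + fderiv ℝ (u p.1) p.2 (EuclideanSpace.single 1 1) 1 +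
        fderiv ℝ (u p.1) p.2 (EuclideanSpace.single 2 1) 2 = 0) →
      (∀ p ∈ U, ∀ b : Fin 3, b ≠ 2 →
        fderiv ℝ (u p.1) p.2 (EuclideanSpace.single 2 1) b =
          μ p.1 (p.2 2) * fderiv ℝ (u p.1) p.2 (EuclideanSpace.single b 1) 2) →
      (∀ p ∈ U,
        (1 - μ p.1 (p.2 2)) *
            (deriv (fun s => u s p.2 2) p.1 + fderiv ℝ (fun y => u p.1 y 2) p.2 (u p.1 p.2)
              - Δ (fun y => u p.1 y 2) p.2) =
          A p.1 (p.2 2) + (deriv (fun s => μ s (p.2 2)) p.1 - deriv (deriv (μ p.1)) (p.2 2)) * u p.1 p.2 2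
            + deriv (μ p.1) (p.2 2) / 2 * u p.1 p.2 2 ^ 2
            - 2 * deriv (μ p.1) (p.2 2) * fderiv ℝ (u p.1) p.2 (EuclideanSpace.single 2 1) 2) →
      fderiv ℝ (fun y => fderiv ℝ (u p₀.1) y (EuclideanSpace.single 2 1) 2) p₀.2 (EuclideanSpace.single 0 1) *
            fderiv ℝ (u p₀.1) p₀.2 (EuclideanSpace.single 1 1) 2 -
          fderiv ℝ (fun y => fderiv ℝ (u p₀.1) y (EuclideanSpace.single 2 1) 2) p₀.2 (EuclideanSpace.single 1 1) *
            fderiv ℝ (u p₀.1) p₀.2 (EuclideanSpace.single 0 1) 2 ≠ 0 →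
      μ p₀.1 (p₀.2 2) ≠ 0 → μ p₀.1 (p₀.2 2) ≠ 1 → deriv (μ p₀.1) (p₀.2 2) ≠ 0 →
      μ p₀.1 (p₀.2 2) < 0 →
      (fderiv ℝ (u p₀.1) p₀.2 (EuclideanSpace.single 0 1) 0 ≠ fderiv ℝ (u p₀.1) p₀.2 (EuclideanSpace.single 1 1) 1 ∨
        fderiv ℝ (u p₀.1) p₀.2 (EuclideanSpace.single 1 1) 0 ≠ 0) →
      u p₀.1 p₀.2 = 0 → 
      fderiv ℝ (u p₀.1) p₀.2 (EuclideanSpace.single 0 1) 2 = 0 →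
      fderiv ℝ (u p₀.1) p₀.2 (EuclideanSpace.single 1 1) 2 = 1 → False := by
  sorry

/-- **STUB S1 (provable, M; SHARED verbatim with line `far_thread`): EXTREMAL RECENTRING — a poloidal class profile with `v₂ ≢ 0` has a companion in the SAME class (same
constant `C`), poloidal, whose scale-invariant vertical size `√(−t)|v₂(t,x)|` ATTAINS its supremum over the slab at the hot spot `(−1,0)`.**
Proof route (all ingredients in the tree): `N := sup √(−t)|v₂| ∈ (0, C]`; near-maximisers `(t_k, x_k)`; `v_k := λ_k v(λ_k² ·, x_k + λ_k ·)`,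
`λ_k = √(−t_k)` (class and poloidality are invariant: `…PoloidalExtremal.poloidal_translate/poloidal_nsRescale`, `isTypeIAncientMild_of_class`);
KNSS compactness `…SqueezeCycleExtremalElementExistsExtraction.exists_tendsto_of_isTypeIAncientMild_seq` (fields and gradients converge, so the
limit is poloidal: `poloidal_of_tendsto`); pointwise limits give `√(−t)|v'₂| ≤ N` everywhere and `|v'₂(−1,0)| = N`.  No minimality, no
ε-regularity.  A thread for free: `threadPin_of_hotSpot` below. -/
theorem stub_extremalThread :
    ∀ (C : ℝ) (v : ℝ → EuclideanSpace ℝ (Fin 3) → EuclideanSpace ℝ (Fin 3)),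
      Literature.Analysis.FluidPDE.HasTypeITimeDecay C v →
      ContinuousOn (Function.uncurry v) (Set.Iio (0 : ℝ) ×ˢ Set.univ) →
      (∀ s t : ℝ, s < t → t < 0 → ∀ x, v t x =
        Literature.Analysis.UnboundedOperators.heatExtension (v s) (t - s) x -
          Literature.Analysis.FluidPDE.oseenDuhamel 1 s v v t x) →
      (∀ t < 0, Literature.Analysis.FluidPDE.VectorCalculus.IsDivFree (v t)) →
      (∀ s < 0, ∀ y, ⟪Literature.Analysis.FluidPDE.curl (v s) y, EuclideanSpace.single 2 1⟫_ℝ = 0) →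
      (∃ t₀ : ℝ, t₀ < 0 ∧ ∃ y₀ : EuclideanSpace ℝ (Fin 3), v t₀ y₀ 2 ≠ 0) →
      ∃ v' : ℝ → EuclideanSpace ℝ (Fin 3) → EuclideanSpace ℝ (Fin 3),
        Literature.Analysis.FluidPDE.HasTypeITimeDecay C v' ∧
        ContinuousOn (Function.uncurry v') (Set.Iio (0 : ℝ) ×ˢ Set.univ) ∧
        (∀ s t : ℝ, s < t → t < 0 → ∀ x, v' t x =
          Literature.Analysis.UnboundedOperators.heatExtension (v' s) (t - s) x -
            Literature.Analysis.FluidPDE.oseenDuhamel 1 s v' v' t x) ∧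
        (∀ t < 0, Literature.Analysis.FluidPDE.VectorCalculus.IsDivFree (v' t)) ∧
        (∀ s < 0, ∀ y, ⟪Literature.Analysis.FluidPDE.curl (v' s) y, EuclideanSpace.single 2 1⟫_ℝ = 0) ∧
        v' (-1) 0 2 ≠ 0 ∧ (∀ t < 0, ∀ x, Real.sqrt (-t) * |v' t x 2| ≤ |v' (-1) 0 2|) := by
  sorry

/-- **STUB S2 (provable, M; SHARED verbatim with line `far_thread`; used only on the NON-MORSE residue branch): THE POINT DICHOTOMY AT `z₀`** — continuity of the Jacobian entries and of the twist bracket on the slab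
(`…K2OfLrcSlope.continuousOn_fderiv_entry`, `…ThmARelocation.continuousOn_twist`) only.  For a poloidal class profile and a point `z₀` of the
backward slab, ONE of: (i) an open `W ⊆ slab` of non-degenerate TWISTING points which is THICK (the slope `∂₂v_b/∂_bv₂` is a function of
`(t, x₂)` on NO open subset) and ACCUMULATES at `z₀`; (ii) a non-degenerate UNTWISTED window; (iii) a non-degenerate, pinned, twisting (TH)
window; (iv) a window with TIME-ONLY slope; (v) an open DEGENERATE germ on one slice (irrotational / horizontally flat / vertically rigid).
Proof sketch: `O := slab ∩ {ND ∧ T ≠ 0}` is open; if `z₀ ∈ closure O` then (i) with `W = O` unless thickness fails on a sub-window (⇒ (iii),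
or (iv) if its pin fails); else a ball about `z₀` misses `O`: a non-degenerate point in it gives (ii), otherwise the pointwise degenerate
disjunction on the ball's `z₀.1`-slice splits into (v) by `…DegenerateSlice.forall_or_exists_open_of_pointwise_or`. -/
theorem stub_threadDichotomy :
    ∀ (C : ℝ) (v : ℝ → EuclideanSpace ℝ (Fin 3) → EuclideanSpace ℝ (Fin 3)),
      Literature.Analysis.FluidPDE.HasTypeITimeDecay C v →
      ContinuousOn (Function.uncurry v) (Set.Iio (0 : ℝ) ×ˢ Set.univ) →
      (∀ s t : ℝ, s < t → t < 0 → ∀ x, v t x =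
        Literature.Analysis.UnboundedOperators.heatExtension (v s) (t - s) x -
          Literature.Analysis.FluidPDE.oseenDuhamel 1 s v v t x) →
      (∀ t < 0, Literature.Analysis.FluidPDE.VectorCalculus.IsDivFree (v t)) →
      (∀ s < 0, ∀ y, ⟪Literature.Analysis.FluidPDE.curl (v s) y, EuclideanSpace.single 2 1⟫_ℝ = 0) →
      ∀ z₀ : ℝ × EuclideanSpace ℝ (Fin 3), z₀.1 < 0 →
        (∃ W : Set (ℝ × EuclideanSpace ℝ (Fin 3)), IsOpen W ∧ W ⊆ Set.Iio (0 : ℝ) ×ˢ Set.univ ∧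
          (∀ z ∈ W, (Literature.Analysis.FluidPDE.curl (v z.1) z.2 ≠ 0 ∧
            (fderiv ℝ (v z.1) z.2 (EuclideanSpace.single 0 1) 2 ≠ 0 ∨ fderiv ℝ (v z.1) z.2 (EuclideanSpace.single 1 1) 2 ≠ 0) ∧
            (fderiv ℝ (v z.1) z.2 (EuclideanSpace.single 2 1) 0 ≠ 0 ∨ fderiv ℝ (v z.1) z.2 (EuclideanSpace.single 2 1) 1 ≠ 0)) ∧
            (fderiv ℝ (fun x => fderiv ℝ (v z.1) x (EuclideanSpace.single 2 1) 2) z.2 (EuclideanSpace.single 0 1) *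
                fderiv ℝ (v z.1) z.2 (EuclideanSpace.single 1 1) 2 -
              fderiv ℝ (fun x => fderiv ℝ (v z.1) x (EuclideanSpace.single 2 1) 2) z.2 (EuclideanSpace.single 1 1) *
                fderiv ℝ (v z.1) z.2 (EuclideanSpace.single 0 1) 2 ≠ 0)) ∧
          (∀ m : ℝ → ℝ → ℝ, ∀ W₁ : Set (ℝ × EuclideanSpace ℝ (Fin 3)), W₁ ⊆ W → IsOpen W₁ → W₁.Nonempty →
            ∃ z ∈ W₁, ∃ b : Fin 3, b ≠ 2 ∧
              fderiv ℝ (v z.1) z.2 (EuclideanSpace.single 2 1) b ≠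
                m z.1 (z.2 2) * fderiv ℝ (v z.1) z.2 (EuclideanSpace.single b 1) 2) ∧
          (∀ r : ℝ, 0 < r → (Metric.ball z₀ r ∩ W).Nonempty)) ∨
        (∃ W : Set (ℝ × EuclideanSpace ℝ (Fin 3)), IsOpen W ∧ W.Nonempty ∧ W ⊆ Set.Iio (0 : ℝ) ×ˢ Set.univ ∧
          (∀ z ∈ W, (Literature.Analysis.FluidPDE.curl (v z.1) z.2 ≠ 0 ∧
            (fderiv ℝ (v z.1) z.2 (EuclideanSpace.single 0 1) 2 ≠ 0 ∨ fderiv ℝ (v z.1) z.2 (EuclideanSpace.single 1 1) 2 ≠ 0) ∧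
            (fderiv ℝ (v z.1) z.2 (EuclideanSpace.single 2 1) 0 ≠ 0 ∨ fderiv ℝ (v z.1) z.2 (EuclideanSpace.single 2 1) 1 ≠ 0))) ∧
          (∀ z ∈ W, (fderiv ℝ (fun x => fderiv ℝ (v z.1) x (EuclideanSpace.single 2 1) 2) z.2 (EuclideanSpace.single 0 1) *
                fderiv ℝ (v z.1) z.2 (EuclideanSpace.single 1 1) 2 -
              fderiv ℝ (fun x => fderiv ℝ (v z.1) x (EuclideanSpace.single 2 1) 2) z.2 (EuclideanSpace.single 1 1) *
                fderiv ℝ (v z.1) z.2 (EuclideanSpace.single 0 1) 2 = 0))) ∨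
        (∃ W : Set (ℝ × EuclideanSpace ℝ (Fin 3)), IsOpen W ∧ W.Nonempty ∧ W ⊆ Set.Iio (0 : ℝ) ×ˢ Set.univ ∧
          (∀ z ∈ W, (Literature.Analysis.FluidPDE.curl (v z.1) z.2 ≠ 0 ∧
            (fderiv ℝ (v z.1) z.2 (EuclideanSpace.single 0 1) 2 ≠ 0 ∨ fderiv ℝ (v z.1) z.2 (EuclideanSpace.single 1 1) 2 ≠ 0) ∧
            (fderiv ℝ (v z.1) z.2 (EuclideanSpace.single 2 1) 0 ≠ 0 ∨ fderiv ℝ (v z.1) z.2 (EuclideanSpace.single 2 1) 1 ≠ 0))) ∧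
          (∀ m : ℝ → ℝ, ∀ W₁ : Set (ℝ × EuclideanSpace ℝ (Fin 3)), W₁ ⊆ W → IsOpen W₁ → W₁.Nonempty →
            ∃ z ∈ W₁, ∃ b : Fin 3, b ≠ 2 ∧
              fderiv ℝ (v z.1) z.2 (EuclideanSpace.single 2 1) b ≠
                m z.1 * fderiv ℝ (v z.1) z.2 (EuclideanSpace.single b 1) 2) ∧
          (∀ z ∈ W, (fderiv ℝ (fun x => fderiv ℝ (v z.1) x (EuclideanSpace.single 2 1) 2) z.2 (EuclideanSpace.single 0 1) *
                fderiv ℝ (v z.1) z.2 (EuclideanSpace.single 1 1) 2 -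
              fderiv ℝ (fun x => fderiv ℝ (v z.1) x (EuclideanSpace.single 2 1) 2) z.2 (EuclideanSpace.single 1 1) *
                fderiv ℝ (v z.1) z.2 (EuclideanSpace.single 0 1) 2 ≠ 0)) ∧
          (∃ m : ℝ → ℝ → ℝ, ∀ z ∈ W, ∀ b : Fin 3, b ≠ 2 →
            fderiv ℝ (v z.1) z.2 (EuclideanSpace.single 2 1) b =
              m z.1 (z.2 2) * fderiv ℝ (v z.1) z.2 (EuclideanSpace.single b 1) 2)) ∨
        (∃ W : Set (ℝ × EuclideanSpace ℝ (Fin 3)), IsOpen W ∧ W.Nonempty ∧ W ⊆ Set.Iio (0 : ℝ) ×ˢ Set.univ ∧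
          (∃ m : ℝ → ℝ, ∀ z ∈ W, ∀ b : Fin 3, b ≠ 2 →
            fderiv ℝ (v z.1) z.2 (EuclideanSpace.single 2 1) b =
              m z.1 * fderiv ℝ (v z.1) z.2 (EuclideanSpace.single b 1) 2)) ∨
        (∃ s : ℝ, s < 0 ∧ ∃ U : Set (EuclideanSpace ℝ (Fin 3)), IsOpen U ∧ U.Nonempty ∧
          ((∀ y ∈ U, Literature.Analysis.FluidPDE.curl (v s) y = 0) ∨
           (∀ y ∈ U, fderiv ℝ (v s) y (EuclideanSpace.single 0 1) 2 = 0 ∧ fderiv ℝ (v s) y (EuclideanSpace.single 1 1) 2 = 0) ∨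
           (∀ y ∈ U, fderiv ℝ (v s) y (EuclideanSpace.single 2 1) 0 = 0 ∧ fderiv ℝ (v s) y (EuclideanSpace.single 2 1) 1 = 0))) := by
  sorry

/-- **STUB S3′ (RESEARCH residue; = line `far_thread`'s deciding `stub_threadedThickEmpty` WEAKENED by the non-Morse hypothesis): THE
FLAT-THREADED THICK COLUMN IS EMPTY.**  No profile of the route's Type-I class (rate, continuity, (M), div-free), poloidal along `e₃`, normalised at
the hot spot (`√(−t)|v₂| ≤ |v₂(−1,0)| ≠ 0`), threaded there (`∇v₂(−1,0) = 0`), whose hot spot is NOT MORSE (some horizontal direction `e` with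
`∂_e∂_e v₂(−1,0) = 0`), carries non-degenerate twisting THICK windows accumulating at `(−1,0)`.  Strictly weaker than far_thread's S3 (one more
hypothesis); any proof of S3 closes it; its own handle: at a flat hot spot `v₂(−1, se, 0) − v₂* = O(s⁴)` with a sign, the leaves are cusped, and
`Δₕv₂(−1,0)` is the single curvature `∂_{e⊥}∂_{e⊥}v₂` — the K-48 relation `w_zz = −ΛΔₕw` and the signed pin of far_thread then involve one
principal curvature only. -/
theorem stub_threadedThickEmptyFlat :
    ∀ (C : ℝ) (v : ℝ → EuclideanSpace ℝ (Fin 3) → EuclideanSpace ℝ (Fin 3)),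
      Literature.Analysis.FluidPDE.HasTypeITimeDecay C v →
      ContinuousOn (Function.uncurry v) (Set.Iio (0 : ℝ) ×ˢ Set.univ) →
      (∀ s t : ℝ, s < t → t < 0 → ∀ x, v t x =
        Literature.Analysis.UnboundedOperators.heatExtension (v s) (t - s) x -
          Literature.Analysis.FluidPDE.oseenDuhamel 1 s v v t x) →
      (∀ t < 0, Literature.Analysis.FluidPDE.VectorCalculus.IsDivFree (v t)) →
      (∀ s < 0, ∀ y, ⟪Literature.Analysis.FluidPDE.curl (v s) y, EuclideanSpace.single 2 1⟫_ℝ = 0) →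
      v (-1) 0 2 ≠ 0 → (∀ t < 0, ∀ x, Real.sqrt (-t) * |v t x 2| ≤ |v (-1) 0 2|) →
      (∀ h : EuclideanSpace ℝ (Fin 3), fderiv ℝ (v (-1)) 0 h 2 = 0) →
      (deriv (fun s => v s 0 2) (-1) = v (-1) 0 2 / 2 ∧ v (-1) 0 2 * (Δ (fun y => v (-1) y 2)) 0 ≤ 0) →
      (∃ e : EuclideanSpace ℝ (Fin 3), e ≠ 0 ∧ e 2 = 0 ∧
        fderiv ℝ (fun x => fderiv ℝ (fun y => v (-1) y 2) x e) 0 e = 0) →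
      ∀ W : Set (ℝ × EuclideanSpace ℝ (Fin 3)), IsOpen W → W ⊆ Set.Iio (0 : ℝ) ×ˢ Set.univ →
        (∀ z ∈ W, (Literature.Analysis.FluidPDE.curl (v z.1) z.2 ≠ 0 ∧
            (fderiv ℝ (v z.1) z.2 (EuclideanSpace.single 0 1) 2 ≠ 0 ∨ fderiv ℝ (v z.1) z.2 (EuclideanSpace.single 1 1) 2 ≠ 0) ∧
            (fderiv ℝ (v z.1) z.2 (EuclideanSpace.single 2 1) 0 ≠ 0 ∨ fderiv ℝ (v z.1) z.2 (EuclideanSpace.single 2 1) 1 ≠ 0)) ∧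
          (fderiv ℝ (fun x => fderiv ℝ (v z.1) x (EuclideanSpace.single 2 1) 2) z.2 (EuclideanSpace.single 0 1) *
                fderiv ℝ (v z.1) z.2 (EuclideanSpace.single 1 1) 2 -
              fderiv ℝ (fun x => fderiv ℝ (v z.1) x (EuclideanSpace.single 2 1) 2) z.2 (EuclideanSpace.single 1 1) *
                fderiv ℝ (v z.1) z.2 (EuclideanSpace.single 0 1) 2 ≠ 0)) →
        (∀ m : ℝ → ℝ → ℝ, ∀ W₁ : Set (ℝ × EuclideanSpace ℝ (Fin 3)), W₁ ⊆ W → IsOpen W₁ → W₁.Nonempty →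
            ∃ z ∈ W₁, ∃ b : Fin 3, b ≠ 2 ∧
              fderiv ℝ (v z.1) z.2 (EuclideanSpace.single 2 1) b ≠
                m z.1 (z.2 2) * fderiv ℝ (v z.1) z.2 (EuclideanSpace.single b 1) 2) →
        (∀ r : ℝ, 0 < r → (Metric.ball ((-1 : ℝ), (0 : EuclideanSpace ℝ (Fin 3))) r ∩ W).Nonempty) →
        False := by
  sorry

/-- **S6Y: THE YORKE × TYPE-I PERIOD FLOOR (v7: a COROLLARY OF THE TREE — `LoopPeriodRatchetPeriodScalingBound.periodScalingBound_proof`,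
route `LoopPeriodRatchet` of ideator ns-idea-1 g0, item `PeriodScalingBound`, PROVED there from the weak Yorke bound `inv_period_le_of_lipschitzWith`
and the class smoothing rates `exists_spaceTime_rate_of_class`; v5's stub `stub_periodFloorYorke`, same statement verbatim; v6's own proof via
`one_le_lip_mul_period` + the smoothing stub S6L is superseded and kept only in the rung file).**  Every non-stationary periodic vortex line of a
class profile at time `t < 0` has period `T ≥ c₀ (−t)^{3/2}`, `c₀ = 1 / max M 1` with `M = M(C)` the tree's constant. -/
theorem periodFloorYorke :
    ∀ (C : ℝ) (v : ℝ → EuclideanSpace ℝ (Fin 3) → EuclideanSpace ℝ (Fin 3)),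
      Literature.Analysis.FluidPDE.HasTypeITimeDecay C v →
      ContinuousOn (Function.uncurry v) (Set.Iio (0 : ℝ) ×ˢ Set.univ) →
      (∀ s t : ℝ, s < t → t < 0 → ∀ x, v t x =
        Literature.Analysis.UnboundedOperators.heatExtension (v s) (t - s) x -
          Literature.Analysis.FluidPDE.oseenDuhamel 1 s v v t x) →
      (∀ t < 0, Literature.Analysis.FluidPDE.VectorCalculus.IsDivFree (v t)) →
      ∃ c₀ : ℝ, 0 < c₀ ∧ ∀ t < 0, ∀ (c : ℝ → EuclideanSpace ℝ (Fin 3)) (T : ℝ), 0 < T → Function.Periodic c T →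
        (∀ s, HasDerivAt c (Literature.Analysis.FluidPDE.curl (v t) (c s)) s) →
        (∃ s, Literature.Analysis.FluidPDE.curl (v t) (c s) ≠ 0) →
        c₀ * (-t) ^ ((3 : ℝ) / 2) ≤ T := by
  intro C v hrate hcont hmild hdiv
  obtain ⟨M, hM⟩ := Summit.NavierStokesRegularity.NavierStokesRegularity.Theorems.LoopPeriodRatchetPeriodScalingBound.periodScalingBound_proof C
  set M' : ℝ := max M 1 with hM'
  have hM'pos : 0 < M' := lt_of_lt_of_le one_pos (le_max_right _ _)
  refine ⟨1 / M', by positivity, fun t ht c T hT hper hder hnz => ?_⟩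
  obtain ⟨s₀, hs₀⟩ := hnz
  -- re-base the orbit at the non-stationary point: γ θ := c (θ + s₀)
  have hγ : ∀ θ, HasDerivAt (fun θ => c (θ + s₀)) (Literature.Analysis.FluidPDE.curl (v t) (c (θ + s₀))) θ := by
    intro θ
    exact HasDerivAt.comp_add_const θ s₀ (hder (θ + s₀))
  have hγper : ∀ θ, (fun θ => c (θ + s₀)) (θ + T) = (fun θ => c (θ + s₀)) θ := by
    intro θ; simp only; rw [show θ + T + s₀ = θ + s₀ + T by ring, hper]
  have hγ0 : Literature.Analysis.FluidPDE.curl (v t) ((fun θ => c (θ + s₀)) 0) ≠ 0 := by simpa using hs₀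
  have key := hM v hrate hcont hmild hdiv t ht (fun θ => c (θ + s₀)) T hT hγ hγper hγ0
  -- key : T⁻¹ ≤ M * (−t)^{−3/2}  ⇒  (1/M')(−t)^{3/2} ≤ T
  have hmt : 0 < (-t) ^ ((3 : ℝ) / 2) := Real.rpow_pos_of_pos (by linarith) _
  have hneg : (-t) ^ (-(3 : ℝ) / 2) = ((-t) ^ ((3 : ℝ) / 2))⁻¹ := by
    rw [show (-(3 : ℝ) / 2) = -((3 : ℝ) / 2) by ring, Real.rpow_neg (by linarith)]
  rw [hneg] at key
  have key' : T⁻¹ ≤ M' * ((-t) ^ ((3 : ℝ) / 2))⁻¹ :=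
    le_trans key (mul_le_mul_of_nonneg_right (le_max_left _ _) (inv_nonneg.2 hmt.le))
  rw [← div_eq_mul_inv, le_div_iff₀ hmt] at key'
  -- key' : T⁻¹ * (−t)^{3/2} ≤ M'
  rw [div_mul_eq_mul_div, div_le_iff₀ hM'pos, one_mul]
  have hTinv : 0 < T⁻¹ := inv_pos.2 hT
  have : (-t) ^ ((3 : ℝ) / 2) ≤ M' / T⁻¹ := by rw [le_div_iff₀ hTinv, mul_comm]; exact key'
  rw [div_inv_eq_mul] at this
  linarith [mul_comm M' T]

/-- **STUB S6G (RESEARCH, deciding, NEW in v5 — THE WALL OF THE LINE, typed: FREQUENCY GROWTH EXPONENT `κ < 3/2`).**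
For a poloidal class profile there are `A > 0` and `κ < 3/2` such that a non-stationary periodic vortex line at time `t` of period `T` forces, at EVERY
earlier time `t₀ ≤ t`, a non-stationary periodic vortex line of period `≤ A·T·((−t₀)/(−t))^κ` — i.e. the fastest orbital frequency
`Θ_max(t) = sup 1/T` grows forward in time at most like `(−t)^{−κ}`.  This is exactly the output of the engine (Z1)+(Z3) of the card: the weak maximum
principle for the Helmholtz frequency `Θ = 2π/T` on the period-annulus region (zero lateral data by period blow-up, Z1) applied to its closed-form law
`D_t log Θ = [Γ′(c) − T′(c)ΔF]/T(c)` (card v6, instrument I8b), whose value AT THE FASTEST LEAF is `Θ²δ″(c) + R_z` (roundness-deficit curvature +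
vertical/twist residue; KNSS: both vanish, `κ = 0`); the stub holds with `κ = κ′` whenever `sup_{t} (−t)[Θ²δ″ + R_z]_{fastest leaf} ≤ κ′`.  The
displayed inequality `κ′ < 3/2` IS the research content: instrument I8a (kit j303867) shows `R_z = τ²(α−β)²/(αβ) ≥ 0` on twisted elliptic columns
(frequency-increasing, scaling-marginal), so NO sign helps and only SIZE can; the engine closes the small-twist/small-deficit neighbourhood of KNSS and
nothing beyond without a new input controlling these two shape quantities.  WEAKER THAN S6 (S6 ⇒ S6G vacuously); with S6Y it GIVES S6
(`noPeriodicVortexLine`, proved below from the pure real-analysis `noOrbit_of_floor_and_growth`).  Why it might fail: a poloidal class profile whose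
fastest vortex ring spins up faster than `(−t)^{−3/2}` relative to the past — e.g. strongly twisted non-isochronous leaves with `(−t)[Θ²δ″+R_z] ≥ 3/2`
persistently; no example is known (the class is conjecturally empty), and the self-similar scaling saturates exactly `κ = 3/2` (the borderline is sharp). -/
theorem stub_frequencyGrowthExponent :
    ∀ (C : ℝ) (v : ℝ → EuclideanSpace ℝ (Fin 3) → EuclideanSpace ℝ (Fin 3)),
      Literature.Analysis.FluidPDE.HasTypeITimeDecay C v →
      ContinuousOn (Function.uncurry v) (Set.Iio (0 : ℝ) ×ˢ Set.univ) →
      (∀ s t : ℝ, s < t → t < 0 → ∀ x, v t x =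
        Literature.Analysis.UnboundedOperators.heatExtension (v s) (t - s) x -
          Literature.Analysis.FluidPDE.oseenDuhamel 1 s v v t x) →
      (∀ t < 0, Literature.Analysis.FluidPDE.VectorCalculus.IsDivFree (v t)) →
      (∀ s < 0, ∀ y, ⟪Literature.Analysis.FluidPDE.curl (v s) y, EuclideanSpace.single 2 1⟫_ℝ = 0) →
      ∃ A κ : ℝ, 0 < A ∧ κ < 3 / 2 ∧ ∀ t₀ t : ℝ, t₀ ≤ t → t < 0 →
        ∀ (c : ℝ → EuclideanSpace ℝ (Fin 3)) (T : ℝ), 0 < T → Function.Periodic c T →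
          (∀ s, HasDerivAt c (Literature.Analysis.FluidPDE.curl (v t) (c s)) s) →
          (∃ s, Literature.Analysis.FluidPDE.curl (v t) (c s) ≠ 0) →
          ∃ (c₀ : ℝ → EuclideanSpace ℝ (Fin 3)) (T₀ : ℝ), 0 < T₀ ∧ Function.Periodic c₀ T₀ ∧
            (∀ s, HasDerivAt c₀ (Literature.Analysis.FluidPDE.curl (v t₀) (c₀ s)) s) ∧
            (∃ s, Literature.Analysis.FluidPDE.curl (v t₀) (c₀ s) ≠ 0) ∧
            T₀ ≤ A * T * ((-t₀) / (-t)) ^ κ := by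
  sorry

/-- **CERTIFICATE (v7, sorry-free): S6G IS A WEAKENING OF `LoopPeriodRatchet.PeriodRatchet`** (the deciding crux of route `LoopPeriodRatchet`,
ideator ns-idea-1 g0: the sup of inverse periods of closed vortex lines is non-increasing in time, with `δ`-slack).  The monotone ratchet gives the
growth-exponent statement with `A = 2`, `κ = 0` (take `δ = 1/(2T)`).  So this line's engine node is AT MOST as hard as theirs; the converse is not
claimed (instrument I8a, card v5: on twisted elliptic columns the heat variation RAISES the top frequency at first order, so the natural pointwise
form of the ratchet fails off symmetry for general poloidal data, while an exponent `κ > 0` can absorb it). -/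
theorem frequencyGrowthExponent_of_periodRatchet
    (hR : Summit.NavierStokesRegularity.NavierStokesRegularity.Theses.LoopPeriodRatchet.PeriodRatchet) :
    ∀ (C : ℝ) (v : ℝ → EuclideanSpace ℝ (Fin 3) → EuclideanSpace ℝ (Fin 3)),
      Literature.Analysis.FluidPDE.HasTypeITimeDecay C v →
      ContinuousOn (Function.uncurry v) (Set.Iio (0 : ℝ) ×ˢ Set.univ) →
      (∀ s t : ℝ, s < t → t < 0 → ∀ x, v t x =
        Literature.Analysis.UnboundedOperators.heatExtension (v s) (t - s) x -
          Literature.Analysis.FluidPDE.oseenDuhamel 1 s v v t x) →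
      (∀ t < 0, Literature.Analysis.FluidPDE.VectorCalculus.IsDivFree (v t)) →
      (∀ s < 0, ∀ y, ⟪Literature.Analysis.FluidPDE.curl (v s) y, EuclideanSpace.single 2 1⟫_ℝ = 0) →
      ∃ A κ : ℝ, 0 < A ∧ κ < 3 / 2 ∧ ∀ t₀ t : ℝ, t₀ ≤ t → t < 0 →
        ∀ (c : ℝ → EuclideanSpace ℝ (Fin 3)) (T : ℝ), 0 < T → Function.Periodic c T →
          (∀ s, HasDerivAt c (Literature.Analysis.FluidPDE.curl (v t) (c s)) s) →
          (∃ s, Literature.Analysis.FluidPDE.curl (v t) (c s) ≠ 0) →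
          ∃ (c₀ : ℝ → EuclideanSpace ℝ (Fin 3)) (T₀ : ℝ), 0 < T₀ ∧ Function.Periodic c₀ T₀ ∧
            (∀ s, HasDerivAt c₀ (Literature.Analysis.FluidPDE.curl (v t₀) (c₀ s)) s) ∧
            (∃ s, Literature.Analysis.FluidPDE.curl (v t₀) (c₀ s) ≠ 0) ∧
            T₀ ≤ A * T * ((-t₀) / (-t)) ^ κ := by
  intro C v hrate hcont hmild hdiv hpol
  refine ⟨2, 0, two_pos, by norm_num, fun t₀ t ht₀ ht c T hT hper hder hnz => ?_⟩
  rw [Real.rpow_zero, mul_one]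
  obtain ⟨s₀, hs₀⟩ := hnz
  rcases eq_or_lt_of_le ht₀ with heq | hlt
  · -- same time: the orbit itself, `T ≤ 2T`
    subst heq
    exact ⟨c, T, hT, hper, hder, ⟨s₀, hs₀⟩, by linarith⟩
  · -- earlier time: the ratchet with δ = 1/(2T), after re-basing the orbit at the non-stationary point
    have hγ : ∀ θ, HasDerivAt (fun θ => c (θ + s₀)) (Literature.Analysis.FluidPDE.curl (v t) (c (θ + s₀))) θ := by
      intro θ
      exact HasDerivAt.comp_add_const θ s₀ (hder (θ + s₀))
    have hγper : ∀ θ, (fun θ => c (θ + s₀)) (θ + T) = (fun θ => c (θ + s₀)) θ := by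
      intro θ; simp only; rw [show θ + T + s₀ = θ + s₀ + T by ring, hper]
    have hγ0 : Literature.Analysis.FluidPDE.curl (v t) ((fun θ => c (θ + s₀)) 0) ≠ 0 := by simpa using hs₀
    have hδ : (0 : ℝ) < 1 / (2 * T) := by positivity
    obtain ⟨γ₁, ℓ₁, hℓ₁, hγ₁, hγ₁per, hγ₁0, hle⟩ :=
      hR C v hrate hcont hmild hdiv hpol t₀ t hlt ht (fun θ => c (θ + s₀)) T hT hγ hγper hγ0 (1 / (2 * T)) hδ
    refine ⟨γ₁, ℓ₁, hℓ₁, fun θ => hγ₁per θ, hγ₁, ⟨0, hγ₁0⟩, ?_⟩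
    -- T⁻¹ ≤ ℓ₁⁻¹ + 1/(2T)  ⇒  ℓ₁ ≤ 2T
    have h1 : 1 / (2 * T) ≤ ℓ₁⁻¹ := by
      have : T⁻¹ = 1 / (2 * T) + 1 / (2 * T) := by field_simp; ring
      linarith
    rw [one_div, inv_le_inv₀ (by positivity) hℓ₁] at h1
    linarith

/-- **ENGINE THEOREM (v5, sorry-free; pure real analysis): a PERIOD FLOOR `c₀(−t)^{3/2} ≤ T` and a backward GROWTH EXPONENT `κ < 3/2` are
incompatible with the existence of any orbit.**  `P t T` = «at time `t` there is an admissible orbit of period `T`».  From an orbit at `t` one gets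
orbits at all `t₀ = −s ≤ t` with `c₀ s^{3/2} ≤ T₀ ≤ A T (s/(−t))^κ`, i.e. `c₀ s^{3/2−κ} ≤ A T (−t)^{−κ}` for all large `s` — absurd since
`s^{3/2−κ} → ∞` (`tendsto_rpow_atTop`).  This is the kernel record of WHERE THE ENGINE REACHES: everything else in (Z1)–(Z3) is in the two stubs above. -/
theorem noOrbit_of_floor_and_growth {P : ℝ → ℝ → Prop} (c₀ A κ : ℝ) (hc₀ : 0 < c₀) (hA : 0 < A) (hκ : κ < 3 / 2)
    (hY : ∀ t < 0, ∀ T, P t T → c₀ * (-t) ^ ((3 : ℝ) / 2) ≤ T)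
    (hG : ∀ t₀ t : ℝ, t₀ ≤ t → t < 0 → ∀ T, P t T → ∃ T₀, P t₀ T₀ ∧ T₀ ≤ A * T * ((-t₀) / (-t)) ^ κ) :
    ∀ t < 0, ∀ T, ¬ P t T := by
  intro t ht T hP
  have hpos : 0 < (3 : ℝ) / 2 - κ := by linarith
  set B : ℝ := A * T / (-t) ^ κ with hB
  have hev : ∀ᶠ s : ℝ in atTop, B / c₀ + 1 ≤ s ^ ((3 : ℝ) / 2 - κ) := (tendsto_rpow_atTop hpos).eventually_ge_atTop _
  obtain ⟨s, hs1, hs2⟩ := (hev.and (eventually_ge_atTop (max (-t) 1))).exists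
  have hs_pos : 0 < s := lt_of_lt_of_le one_pos (le_trans (le_max_right _ _) hs2)
  have ht0 : -s ≤ t := by linarith [le_trans (le_max_left _ _) hs2]
  obtain ⟨T₀, hP₀, hT₀⟩ := hG (-s) t ht0 ht T hP
  have hfloor := hY (-s) (by linarith) T₀ hP₀
  rw [neg_neg] at hfloor hT₀
  have hmt : 0 < -t := by linarith
  have hsplit : s ^ ((3 : ℝ) / 2) = s ^ ((3 : ℝ) / 2 - κ) * s ^ κ := by
    rw [← Real.rpow_add hs_pos]; ring_nf
  have hdiv : (s / -t) ^ κ = s ^ κ / (-t) ^ κ := Real.div_rpow hs_pos.le hmt.le κ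
  have hsk : 0 < s ^ κ := Real.rpow_pos_of_pos hs_pos κ
  have htk : 0 < (-t) ^ κ := Real.rpow_pos_of_pos hmt κ
  have hchain : c₀ * (s ^ ((3 : ℝ) / 2 - κ) * s ^ κ) ≤ A * T * (s ^ κ / (-t) ^ κ) := by
    rw [← hsplit, ← hdiv]; exact le_trans hfloor hT₀
  have hchain' : c₀ * s ^ ((3 : ℝ) / 2 - κ) ≤ B := by
    rw [hB]
    have := div_le_div_of_nonneg_right hchain hsk.le
    have e1 : c₀ * (s ^ ((3 : ℝ) / 2 - κ) * s ^ κ) / s ^ κ = c₀ * s ^ ((3 : ℝ) / 2 - κ) := by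
      field_simp
    have e2 : A * T * (s ^ κ / (-t) ^ κ) / s ^ κ = A * T / (-t) ^ κ := by
      field_simp
    rw [e1, e2] at this; exact this
  have : B + c₀ ≤ c₀ * s ^ ((3 : ℝ) / 2 - κ) := by
    have := mul_le_mul_of_nonneg_left hs1 hc₀.le
    rw [mul_add, mul_one, mul_div_cancel₀ _ hc₀.ne'] at this; exact this
  linarith

/-- **S6: NO PERIODIC VORTEX LINE (v5: PROVED from S6Y + S6G by `noOrbit_of_floor_and_growth`; v3/v4's deciding stub `stub_noPeriodicVortexLine`,
same statement verbatim).**  A profile of the route's Type-I ancient mild class that is poloidal along `e₃` has, at every negative time, no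
non-stationary periodic integral curve of its vorticity field: every `T`-periodic solution `c` of `ċ = ω(t, c)` consists of zeros of `ω(t,·)`.
DICTIONARY: vortex lines are horizontal (`ω ⊥ e₃`), `ω(t,·,z) = ∇ₕF × e₃` is a planar HAMILTONIAN field, its closed orbits are the closed leaves
`{F = c}`, and the Helmholtz invariant `Θ = ∂F/∂𝒜 = 2π/T` is their orbital FREQUENCY (`= ω_θ/r` on KNSS's circles).  ENGINE: (Z2) = S6Y (period
floor, provable), (Z1)+(Z3)+residue bound = S6G (growth exponent `< 3/2`, research), contradiction = `noOrbit_of_floor_and_growth` (proved).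
RUNG: axisymmetric swirl-free case, sorry-free, `Lines/thread_axis_rung.lean` (`noPeriodicVortexLine_rung_axisym`). -/
theorem noPeriodicVortexLine_of
    (hG :
      ∀ (C : ℝ) (v : ℝ → EuclideanSpace ℝ (Fin 3) → EuclideanSpace ℝ (Fin 3)),
      Literature.Analysis.FluidPDE.HasTypeITimeDecay C v →
      ContinuousOn (Function.uncurry v) (Set.Iio (0 : ℝ) ×ˢ Set.univ) →
      (∀ s t : ℝ, s < t → t < 0 → ∀ x, v t x =
        Literature.Analysis.UnboundedOperators.heatExtension (v s) (t - s) x -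
          Literature.Analysis.FluidPDE.oseenDuhamel 1 s v v t x) →
      (∀ t < 0, Literature.Analysis.FluidPDE.VectorCalculus.IsDivFree (v t)) →
      (∀ s < 0, ∀ y, ⟪Literature.Analysis.FluidPDE.curl (v s) y, EuclideanSpace.single 2 1⟫_ℝ = 0) →
      ∃ A κ : ℝ, 0 < A ∧ κ < 3 / 2 ∧ ∀ t₀ t : ℝ, t₀ ≤ t → t < 0 →
        ∀ (c : ℝ → EuclideanSpace ℝ (Fin 3)) (T : ℝ), 0 < T → Function.Periodic c T →
          (∀ s, HasDerivAt c (Literature.Analysis.FluidPDE.curl (v t) (c s)) s) →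
          (∃ s, Literature.Analysis.FluidPDE.curl (v t) (c s) ≠ 0) →
          ∃ (c₀ : ℝ → EuclideanSpace ℝ (Fin 3)) (T₀ : ℝ), 0 < T₀ ∧ Function.Periodic c₀ T₀ ∧
            (∀ s, HasDerivAt c₀ (Literature.Analysis.FluidPDE.curl (v t₀) (c₀ s)) s) ∧
            (∃ s, Literature.Analysis.FluidPDE.curl (v t₀) (c₀ s) ≠ 0) ∧
            T₀ ≤ A * T * ((-t₀) / (-t)) ^ κ) :
    ∀ (C : ℝ) (v : ℝ → EuclideanSpace ℝ (Fin 3) → EuclideanSpace ℝ (Fin 3)),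
      Literature.Analysis.FluidPDE.HasTypeITimeDecay C v →
      ContinuousOn (Function.uncurry v) (Set.Iio (0 : ℝ) ×ˢ Set.univ) →
      (∀ s t : ℝ, s < t → t < 0 → ∀ x, v t x =
        Literature.Analysis.UnboundedOperators.heatExtension (v s) (t - s) x -
          Literature.Analysis.FluidPDE.oseenDuhamel 1 s v v t x) →
      (∀ t < 0, Literature.Analysis.FluidPDE.VectorCalculus.IsDivFree (v t)) →
      (∀ s < 0, ∀ y, ⟪Literature.Analysis.FluidPDE.curl (v s) y, EuclideanSpace.single 2 1⟫_ℝ = 0) →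
      ∀ t < 0, ∀ (c : ℝ → EuclideanSpace ℝ (Fin 3)) (T : ℝ), 0 < T → Function.Periodic c T →
        (∀ s, HasDerivAt c (Literature.Analysis.FluidPDE.curl (v t) (c s)) s) →
        ∀ s, Literature.Analysis.FluidPDE.curl (v t) (c s) = 0 := by
  intro C v hrate hcont hmild hdiv hpol t ht c T hT hper hder s
  by_contra hne
  obtain ⟨c₀, hc₀, hY⟩ := periodFloorYorke C v hrate hcont hmild hdiv
  obtain ⟨A, κ, hA, hκ, hG⟩ := hG C v hrate hcont hmild hdiv hpol
  have key := noOrbit_of_floor_and_growth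
    (P := fun t T => 0 < T ∧ ∃ c : ℝ → EuclideanSpace ℝ (Fin 3), Function.Periodic c T ∧
      (∀ s, HasDerivAt c (Literature.Analysis.FluidPDE.curl (v t) (c s)) s) ∧
      ∃ s, Literature.Analysis.FluidPDE.curl (v t) (c s) ≠ 0)
    c₀ A κ hc₀ hA hκ
    (fun t ht T hP => by
      obtain ⟨hT, c, hper, hder, hnz⟩ := hP
      exact hY t ht c T hT hper hder hnz)
    (fun t₀ t ht₀ ht T hP => by
      obtain ⟨hT, c, hper, hder, hnz⟩ := hP
      obtain ⟨c', T₀, hT₀, hper', hder', hnz', hle⟩ := hG t₀ t ht₀ ht c T hT hper hder hnz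
      exact ⟨T₀, ⟨hT₀, c', hper', hder', hnz'⟩, hle⟩)
    t ht T
  exact key ⟨hT, c, hper, hder, s, hne⟩

/-- **S6 — NO PERIODIC VORTEX LINE on this line (THEOREM modulo the deciding stub S6G).** -/
theorem noPeriodicVortexLine :
    ∀ (C : ℝ) (v : ℝ → EuclideanSpace ℝ (Fin 3) → EuclideanSpace ℝ (Fin 3)),
      Literature.Analysis.FluidPDE.HasTypeITimeDecay C v →
      ContinuousOn (Function.uncurry v) (Set.Iio (0 : ℝ) ×ˢ Set.univ) →
      (∀ s t : ℝ, s < t → t < 0 → ∀ x, v t x =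
        Literature.Analysis.UnboundedOperators.heatExtension (v s) (t - s) x -
          Literature.Analysis.FluidPDE.oseenDuhamel 1 s v v t x) →
      (∀ t < 0, Literature.Analysis.FluidPDE.VectorCalculus.IsDivFree (v t)) →
      (∀ s < 0, ∀ y, ⟪Literature.Analysis.FluidPDE.curl (v s) y, EuclideanSpace.single 2 1⟫_ℝ = 0) →
      ∀ t < 0, ∀ (c : ℝ → EuclideanSpace ℝ (Fin 3)) (T : ℝ), 0 < T → Function.Periodic c T →
        (∀ s, HasDerivAt c (Literature.Analysis.FluidPDE.curl (v t) (c s)) s) →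
        ∀ s, Literature.Analysis.FluidPDE.curl (v t) (c s) = 0 :=
  noPeriodicVortexLine_of stub_frequencyGrowthExponent

/-- **S6 from the OTHER ROUTE'S deciding crux (v7, CROSS-ROUTE, sorry-free given `PeriodRatchet`):** `LoopPeriodRatchet.PeriodRatchet` ⇒ no periodic
vortex line, through the certificate `frequencyGrowthExponent_of_periodRatchet`, the tree's period floor and the engine theorem (this re-derives
their proved bookkeeping item `NoLoopsOfRatchet` inside this line's typing). -/
theorem noPeriodicVortexLine_of_periodRatchet
    (hR : Summit.NavierStokesRegularity.NavierStokesRegularity.Theses.LoopPeriodRatchet.PeriodRatchet) :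
    ∀ (C : ℝ) (v : ℝ → EuclideanSpace ℝ (Fin 3) → EuclideanSpace ℝ (Fin 3)),
      Literature.Analysis.FluidPDE.HasTypeITimeDecay C v →
      ContinuousOn (Function.uncurry v) (Set.Iio (0 : ℝ) ×ˢ Set.univ) →
      (∀ s t : ℝ, s < t → t < 0 → ∀ x, v t x =
        Literature.Analysis.UnboundedOperators.heatExtension (v s) (t - s) x -
          Literature.Analysis.FluidPDE.oseenDuhamel 1 s v v t x) →
      (∀ t < 0, Literature.Analysis.FluidPDE.VectorCalculus.IsDivFree (v t)) →
      (∀ s < 0, ∀ y, ⟪Literature.Analysis.FluidPDE.curl (v s) y, EuclideanSpace.single 2 1⟫_ℝ = 0) →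
      ∀ t < 0, ∀ (c : ℝ → EuclideanSpace ℝ (Fin 3)) (T : ℝ), 0 < T → Function.Periodic c T →
        (∀ s, HasDerivAt c (Literature.Analysis.FluidPDE.curl (v t) (c s)) s) →
        ∀ s, Literature.Analysis.FluidPDE.curl (v t) (c s) = 0 :=
  noPeriodicVortexLine_of (frequencyGrowthExponent_of_periodRatchet hR)

/-- **STUB S7′-M (PROVABLE, pure calculus, M/L; v10 — «parametrised Morse package WITH A COVERING CURVE»).**
v10 CHANGE (idea-crit-7 10:40:41Z endorsement): the last conjunct `IsConnected {y | H y = 0}` of v9 is REPLACED by a differentiable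
HORIZONTAL COVERING CURVE of the level circle — `∃ σ σ', (∀ θ, HasDerivAt σ (σ' θ) θ) ∧ (∀ θ, σ' θ 2 = 0) ∧ (∀ θ, dg(σ θ)(σ' θ) = 0) ∧
(∀ θ, H (σ θ) = 0) ∧ (∀ y, H y = 0 → ∃ θ, σ θ = y)` — which the radial-graph parametrisation `θ ↦ x*(p₂) + r(θ)(cos θ, sin θ, 0)` of a
near-top level circle of the horizontally concave `g(·, p₂)` delivers (`r ∈ C¹` by the implicit function theorem on each ray, `g` strictly
radially decreasing on the Morse disc; `σ' ⊥ e₂` because the plane is fixed; `dg(σ') = 0` because `g ∘ σ` is constant).  With this output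
S7′-S is no longer a stub: it is the landed sorry-free `Theorems.PoloidalWindowDoorLrcModEntireLevelSlaving.slaved_along_curve` (theorem `slavedOnLevelCircle` below), and the
skeleton's sorries drop 7 → 6.  (v9 text, superseded, kept for BC4:) **STUB S7′-M (v9 — «parametrised Morse package»).**  Let `g : ℝ³ → ℝ` be `C²` with `|g| ≤ |g(0)| ≠ 0`
(a global extremum of `|g|` at `0`) whose horizontal second derivatives at `0` are non-zero (hence a NON-DEGENERATE horizontal extremum,
definite 2×2 Hessian).  Then there is a nonempty open set `U` (a punctured Morse tube near `0`, off the extremal locus, on levels close to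
the top) such that through every `p ∈ U` passes a BOUNDED, REGULAR, CONNECTED level set `{H = 0}` of a `C¹` map `H : ℝ³ → ℝ²` which, on a
neighbourhood `{χ ≠ 0} ⊇ {H = 0}` of it (`χ` a `C¹` cut-off, `χ = 1` on `{H = 0}`), IS the planar level map `y ↦ (g y − g p, y₂ − p₂)`, with
`∇ₕg ≠ 0` on `{H = 0}`.  Paper proof: uniform horizontal concavity near `0` ⇒ in each plane `y₂ = h`, `|h|` small, `g(·,h)` has a unique
interior maximum and its near-top level sets are radial graphs over a circle (compact, connected, regular); cut `g` off outside a ball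
(`ContDiffBump`) so that the global zero set of `H` is exactly that circle.  Why it might fail (as typed): book-keeping only.  This is the
«S7′-morse» piece of idea-crit-7's 09:53:50Z price; no dynamics, no Navier–Stokes. -/
theorem morseLevelPackage_landed :
    ∀ (g : EuclideanSpace ℝ (Fin 3) → ℝ), ContDiff ℝ 2 g → g 0 ≠ 0 → (∀ x, |g x| ≤ |g 0|) →
      (∀ e : EuclideanSpace ℝ (Fin 3), e ≠ 0 → e 2 = 0 →
        fderiv ℝ (fun x => fderiv ℝ g x e) 0 e ≠ 0) →
      ∃ U : Set (EuclideanSpace ℝ (Fin 3)), IsOpen U ∧ U.Nonempty ∧ ∀ p ∈ U,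
        ∃ (H : EuclideanSpace ℝ (Fin 3) → (Fin 2 → ℝ)) (χ : EuclideanSpace ℝ (Fin 3) → ℝ) (R : ℝ),
          ContDiff ℝ 1 H ∧ ContDiff ℝ 1 χ ∧ H p = 0 ∧
          (∀ y, H y = 0 → ‖y‖ ≤ R) ∧
          (∀ y, H y = 0 → Function.Surjective (fderiv ℝ H y)) ∧
          (∀ y, H y = 0 → χ y = 1) ∧
          (∀ y, χ y ≠ 0 → H y = ![g y - g p, y 2 - p 2]) ∧
          (∀ y, χ y ≠ 0 → ∀ w, fderiv ℝ H y w = ![fderiv ℝ g y w, w 2]) ∧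
          (∀ y, H y = 0 → fderiv ℝ g y (EuclideanSpace.single 0 1) ≠ 0 ∨
            fderiv ℝ g y (EuclideanSpace.single 1 1) ≠ 0) ∧
          ∃ σ σ' : ℝ → EuclideanSpace ℝ (Fin 3),
            (∀ θ, HasDerivAt σ (σ' θ) θ) ∧ (∀ θ, σ' θ 2 = 0) ∧ (∀ θ, fderiv ℝ g (σ θ) (σ' θ) = 0) ∧
            (∀ θ, H (σ θ) = 0) ∧ (∀ y, H y = 0 → ∃ θ, σ θ = y) :=
  Summit.NavierStokesRegularity.NavierStokesRegularity.Theorems.PoloidalWindowDoorLrcModEntireMorseLevelPackage.stub_morseLevelPackage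

/-- the vertical component's derivative is the vertical component of the derivative (copy placed before its first v10 use) -/
theorem fderiv_apply_two' {V : EuclideanSpace ℝ (Fin 3) → EuclideanSpace ℝ (Fin 3)}
    {y : EuclideanSpace ℝ (Fin 3)} (hV : DifferentiableAt ℝ V y) (w : EuclideanSpace ℝ (Fin 3)) :
    fderiv ℝ (fun x => V x 2) y w = fderiv ℝ V y w 2 := by
  have h := (hasFDerivWithinAt_euclidean.mp (hV.hasFDerivAt.hasFDerivWithinAt (s := Set.univ))) 2
  rw [(hasFDerivWithinAt_univ.mp h).fderiv]
  first | rfl | simp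

/-- **S7′-S — SLAVING ON A LEVEL CIRCLE (v10: THEOREM, formerly `stub_slavedOnLevelCircle`; proved from the LANDED curve-form lemma
`Theorems.PoloidalWindowDoorLrcModEntireLevelSlaving.slaved_along_curve`, p632923).**  Let `V : ℝ³ → ℝ³` be `C²` with horizontal curl carried by a `C²` stream function `ψ` and vanishing
planar bracket `{ψ, V₂}ₕ ≡ 0`.  On a level set `{H = 0}` covered by a differentiable horizontal curve `σ` tangent to the `V₂`-levels with
`∇ₕV₂ ≠ 0` on `{H = 0}` (the v10 package of `morseLevelPackage_landed` for `g = V₂`), `∇ₕψ = λ ∇ₕV₂` on `{H = 0}` with ONE constant `λ`.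
(The v9 stub took `IsConnected {H = 0}` instead of the curve and was sorried; superseded.) -/
theorem slavedOnLevelCircle :
    ∀ (V : EuclideanSpace ℝ (Fin 3) → EuclideanSpace ℝ (Fin 3)) (ψ : EuclideanSpace ℝ (Fin 3) → ℝ),
      ContDiff ℝ 2 V → ContDiff ℝ 2 ψ →
      (∀ y, fderiv ℝ ψ y (EuclideanSpace.single 1 1) * fderiv ℝ V y (EuclideanSpace.single 0 1) 2 -
        fderiv ℝ ψ y (EuclideanSpace.single 0 1) * fderiv ℝ V y (EuclideanSpace.single 1 1) 2 = 0) →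
      ∀ (H : EuclideanSpace ℝ (Fin 3) → (Fin 2 → ℝ)),
        (∀ y, H y = 0 → fderiv ℝ (fun x => V x 2) y (EuclideanSpace.single 0 1) ≠ 0 ∨
          fderiv ℝ (fun x => V x 2) y (EuclideanSpace.single 1 1) ≠ 0) →
        ∀ (σ σ' : ℝ → EuclideanSpace ℝ (Fin 3)),
          (∀ θ, HasDerivAt σ (σ' θ) θ) → (∀ θ, σ' θ 2 = 0) →
          (∀ θ, fderiv ℝ (fun x => V x 2) (σ θ) (σ' θ) = 0) →
          (∀ θ, H (σ θ) = 0) → (∀ y, H y = 0 → ∃ θ, σ θ = y) →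
        ∃ lam : ℝ, ∀ y, H y = 0 →
          fderiv ℝ ψ y (EuclideanSpace.single 0 1) = lam * fderiv ℝ (fun x => V x 2) y (EuclideanSpace.single 0 1) ∧
          fderiv ℝ ψ y (EuclideanSpace.single 1 1) = lam * fderiv ℝ (fun x => V x 2) y (EuclideanSpace.single 1 1) := by
  intro V ψ hV hψ hbr H hreg σ σ' hσ hσ2 hσg hσH hcov
  have hg : ContDiff ℝ 2 (fun y => V y 2) := contDiff_euclidean.mp hV 2
  have hVd : ∀ y, DifferentiableAt ℝ V y := fun y => (hV.differentiable (by norm_num)).differentiableAt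
  have hbr' : ∀ y, fderiv ℝ ψ y (EuclideanSpace.single 1 1) * fderiv ℝ (fun x => V x 2) y (EuclideanSpace.single 0 1) -
      fderiv ℝ ψ y (EuclideanSpace.single 0 1) * fderiv ℝ (fun x => V x 2) y (EuclideanSpace.single 1 1) = 0 := by
    intro y
    rw [fderiv_apply_two' (hVd y), fderiv_apply_two' (hVd y)]
    exact hbr y
  obtain ⟨lam, hlam⟩ :=
    Summit.NavierStokesRegularity.NavierStokesRegularity.Theorems.PoloidalWindowDoorLrcModEntireLevelSlaving.slaved_along_curve ψ (fun y => V y 2) hψ hg hbr' σ σ' hσ hσ2 hσg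
    (fun θ => hreg (σ θ) (hσH θ))
  refine ⟨lam, fun y hy => ?_⟩
  obtain ⟨θ, rfl⟩ := hcov y hy
  exact hlam θ

/-- the vertical component's derivative is the vertical component of the derivative [Mathlib plumbing] -/
theorem fderiv_apply_two {V : EuclideanSpace ℝ (Fin 3) → EuclideanSpace ℝ (Fin 3)}
    {y : EuclideanSpace ℝ (Fin 3)} (hV : DifferentiableAt ℝ V y) (w : EuclideanSpace ℝ (Fin 3)) :
    fderiv ℝ (fun x => V x 2) y w = fderiv ℝ V y w 2 := by
  have h := (hasFDerivWithinAt_euclidean.mp (hV.hasFDerivAt.hasFDerivWithinAt (s := Set.univ))) 2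
  rw [(hasFDerivWithinAt_univ.mp h).fderiv]
  first | rfl | simp

/-- **S7′ — THE PURE PLANAR-DYNAMICS CORE of the former S7 (v8 stub; v9/v10 THEOREM from S7′-M `morseLevelPackage_landed` + S7′-S
(v10: the THEOREM `slavedOnLevelCircle`, formerly `stub_slavedOnLevelCircle`) + the tree's S7′-orbit `LoopPeriodRatchetNoPlanarExtremumOrbit.exists_periodic_orbit_of_regular_level`; no Navier–Stokes, no class, no time).**
Let `V : ℝ³ → ℝ³` be `C²` with HORIZONTAL curl carried by a `C²` stream function `ψ` (`curl V = (∂₁ψ, −∂₀ψ, 0)`), and suppose the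
planar Poisson bracket of `ψ` with the vertical component `V₂` vanishes identically (`∂₁ψ·∂₀V₂ − ∂₀ψ·∂₁V₂ ≡ 0`: `V₂` is a first
integral of the planar Hamiltonian field `curl V` on every horizontal plane).  If `|V₂|` attains its maximum at `0`, `V₂(0) ≠ 0`, the
horizontal second derivatives of `V₂` at `0` are all non-zero (Morse), and `curl V` has NO non-stationary periodic orbit, then `curl V`
vanishes on a nonempty open set.  Proof on paper (planar, classical): in each plane `z = z₀`, `|z₀|` small, `V₂(·,z₀)` has a
nondegenerate extremum `γ(z₀)` (implicit functions) whose nearby level curves `K_c` are regular closed curves; the bracket makes `ψ`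
constant on each `K_c`, so `∇ₕψ = ψ̂′(c)∇ₕV₂` on `K_c`; if `ψ̂′(c) ≠ 0` then `curl V` is a nowhere-zero tangent field on the compact
regular curve `K_c`, which is then a periodic orbit (Khovanskii; tree: the `LevelCurveData` machinery of
`LoopPeriodRatchetNoPlanarExtremumLevelOrbit`, `exists_periodic_orbit_of_regular_planar_level`, `exists_periodic_orbit_of_strict_planar_min`)
— excluded; hence `∇ₕψ ≡ 0` on the punctured Morse discs, uniformly in `z₀`, an open set.  v9 KERNEL PROOF: Morse package for `g = V₂` (S7′-M); slaving constant `λ` (S7′-S); if `λ = 0` the curl vanishes at `p`; if `λ ≠ 0` the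
cut-off field `χ • curl V` is `C¹`, tangent to the level sets of `H` (frozen bracket via the tree's `fderiv_apply_curl_two`) and non-vanishing on
`{H = 0}`, so the tree's orbit lemma gives a periodic vortex line through `p` — excluded by hypothesis.
The former S7 (`threadGermOfNPV`, Morse hot spot of a CLASS profile without periodic vortex lines ⇒ irrotational germ) is now a
THEOREM from S7′ and the tree: Clebsch potentials of the slice (`exists_clebsch_slice`), the PROVED frozen constraint
(`PoloidalWindowDoorPoloidalWindowRigidityFirstIntegral.stub_firstIntegral`) and its bracket form (`frozen_bracket`). -/
theorem planarFirstIntegralGerm :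
    ∀ (V : EuclideanSpace ℝ (Fin 3) → EuclideanSpace ℝ (Fin 3)) (ψ : EuclideanSpace ℝ (Fin 3) → ℝ),
      ContDiff ℝ 2 V → ContDiff ℝ 2 ψ →
      (∀ y, Literature.Analysis.FluidPDE.curl V y 0 = fderiv ℝ ψ y (EuclideanSpace.single 1 1) ∧
        Literature.Analysis.FluidPDE.curl V y 1 = -fderiv ℝ ψ y (EuclideanSpace.single 0 1) ∧
        Literature.Analysis.FluidPDE.curl V y 2 = 0) →
      (∀ y, fderiv ℝ ψ y (EuclideanSpace.single 1 1) * fderiv ℝ V y (EuclideanSpace.single 0 1) 2 -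
        fderiv ℝ ψ y (EuclideanSpace.single 0 1) * fderiv ℝ V y (EuclideanSpace.single 1 1) 2 = 0) →
      V 0 2 ≠ 0 → (∀ x, |V x 2| ≤ |V 0 2|) →
      (∀ e : EuclideanSpace ℝ (Fin 3), e ≠ 0 → e 2 = 0 →
        fderiv ℝ (fun x => fderiv ℝ (fun y => V y 2) x e) 0 e ≠ 0) →
      (∀ (c : ℝ → EuclideanSpace ℝ (Fin 3)) (T : ℝ), 0 < T → Function.Periodic c T →
        (∀ s, HasDerivAt c (Literature.Analysis.FluidPDE.curl V (c s)) s) →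
        ∀ s, Literature.Analysis.FluidPDE.curl V (c s) = 0) →
      ∃ U : Set (EuclideanSpace ℝ (Fin 3)), IsOpen U ∧ U.Nonempty ∧
        ∀ y ∈ U, Literature.Analysis.FluidPDE.curl V y = 0 := by
  intro V ψ hV hψ hcomp hbr hne hhot hM hnpv
  have hg : ContDiff ℝ 2 (fun y => V y 2) := contDiff_euclidean.mp hV 2
  obtain ⟨U, hUo, hUne, hU⟩ := morseLevelPackage_landed (fun y => V y 2) hg hne hhot hM
  refine ⟨U, hUo, hUne, fun p hp => ?_⟩
  obtain ⟨H, χ, R, hH, hχ, hHp, hbd, hsurj, hχ1, hHv, hHd, hreg, σ, σ', hσ, hσ2, hσg, hσH, hcov⟩ := hU p hp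
  obtain ⟨lam, hlam⟩ := slavedOnLevelCircle V ψ hV hψ hbr H hreg σ σ' hσ hσ2 hσg hσH hcov
  have hVd : ∀ y, DifferentiableAt ℝ V y := fun y => (hV.differentiable (by norm_num)).differentiableAt
  by_cases hl : lam = 0
  · -- the stream function is horizontally critical on the level circle through `p`
    obtain ⟨h0, h1⟩ := hlam p hHp
    rw [hl, zero_mul] at h0 h1
    obtain ⟨c0, c1, c2⟩ := hcomp p
    ext i
    fin_cases i
    · simpa [h1] using c0
    · simpa [h0] using c1
    · simpa using c2
  · exfalso
    -- the cut-off vorticity field is tangent to the level sets of `H` and non-vanishing on `{H = 0}`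
    have hcurl : ContDiff ℝ 1 (curl V) := contDiff_curl (n := 1) (hV.of_le (by norm_num))
    have hXc : ContDiff ℝ 1 (fun y => χ y • curl V y) := hχ.smul hcurl
    have hXt : ∀ y, fderiv ℝ H y (χ y • curl V y) = 0 := by
      intro y
      by_cases hy : χ y = 0
      · simp [hy]
      · rw [map_smul, hHd y hy]
        obtain ⟨c0, c1, c2⟩ := hcomp y
        have h1 : fderiv ℝ (fun x => V x 2) y (curl V y) = 0 := by
          rw [fderiv_apply_two (hVd y),
            Summit.NavierStokesRegularity.NavierStokesRegularity.Theorems.PoloidalWindowDoorPoloidalWindowRigidityClebsch.fderiv_apply_curl_two V y,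
            c0, c1, c2]
          have := hbr y
          linarith
        ext i
        fin_cases i <;> simp [h1, c2]
    have hXne : ∀ y, H y = 0 → χ y • curl V y ≠ 0 := by
      intro y hy hX0
      rw [hχ1 y hy, one_smul] at hX0
      obtain ⟨c0, c1, -⟩ := hcomp y
      have e1 : fderiv ℝ ψ y (EuclideanSpace.single 1 1) = 0 := by rw [← c0, hX0]; simp
      have e0 : fderiv ℝ ψ y (EuclideanSpace.single 0 1) = 0 := by
        have : curl V y 1 = 0 := by rw [hX0]; simp
        linarith [c1]
      obtain ⟨h0, h1⟩ := hlam y hy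
      rw [e0] at h0
      rw [e1] at h1
      rcases hreg y hy with h | h
      · exact h ((mul_eq_zero.mp h0.symm).resolve_left hl)
      · exact h ((mul_eq_zero.mp h1.symm).resolve_left hl)
    obtain ⟨γ, ℓ, hℓ, hγd, hγp, hγ0, hγH⟩ :=
      Summit.NavierStokesRegularity.NavierStokesRegularity.Theorems.LoopPeriodRatchetNoPlanarExtremumOrbit.exists_periodic_orbit_of_regular_level
        hH hXc hXt hXne hsurj hbd hHp
    have hγd' : ∀ θ, HasDerivAt γ (curl V (γ θ)) θ := fun θ => by
      have h := hγd θ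
      rwa [hχ1 _ (hγH θ), one_smul] at h
    have h0 := hnpv γ ℓ hℓ (fun θ => hγp θ) hγd' 0
    rw [hγ0] at h0
    exact hXne p hHp (by rw [h0, smul_zero])

/-- **S7 — A MORSE HOT SPOT WITHOUT PERIODIC VORTEX LINES IS AN IRROTATIONAL GERM (v8: THEOREM from S7′ + tree; v3–v7's stub
`stub_threadGermOfNPV`, same statement verbatim).**  The fluid content is discharged by name: the slice `v(−1)` is smooth
(`contDiff_slice`), has Clebsch potentials `v(−1) = ∇φ + ψe₃`, `curl v(−1) = (∂₁ψ, −∂₀ψ, 0)` (`exists_clebsch_slice`), and satisfies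
the frozen constraint `⟪Dv(−1)[ω], e₃⟫ = 0` (`stub_firstIntegral`, PROVED in the tree despite its name) hence the bracket identity
(`frozen_bracket`); the hot bound at `t = −1` is the global maximality of `|v₂(−1,·)|` at `0`. -/
theorem threadGermOfNPV :
    ∀ (C : ℝ) (v : ℝ → EuclideanSpace ℝ (Fin 3) → EuclideanSpace ℝ (Fin 3)),
      Literature.Analysis.FluidPDE.HasTypeITimeDecay C v →
      ContinuousOn (Function.uncurry v) (Set.Iio (0 : ℝ) ×ˢ Set.univ) →
      (∀ s t : ℝ, s < t → t < 0 → ∀ x, v t x =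
        Literature.Analysis.UnboundedOperators.heatExtension (v s) (t - s) x -
          Literature.Analysis.FluidPDE.oseenDuhamel 1 s v v t x) →
      (∀ t < 0, Literature.Analysis.FluidPDE.VectorCalculus.IsDivFree (v t)) →
      (∀ s < 0, ∀ y, ⟪Literature.Analysis.FluidPDE.curl (v s) y, EuclideanSpace.single 2 1⟫_ℝ = 0) →
      v (-1) 0 2 ≠ 0 → (∀ t < 0, ∀ x, Real.sqrt (-t) * |v t x 2| ≤ |v (-1) 0 2|) →
      (∀ e : EuclideanSpace ℝ (Fin 3), e ≠ 0 → e 2 = 0 →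
        fderiv ℝ (fun x => fderiv ℝ (fun y => v (-1) y 2) x e) 0 e ≠ 0) →
      (∀ (c : ℝ → EuclideanSpace ℝ (Fin 3)) (T : ℝ), 0 < T → Function.Periodic c T →
        (∀ s, HasDerivAt c (Literature.Analysis.FluidPDE.curl (v (-1)) (c s)) s) →
        ∀ s, Literature.Analysis.FluidPDE.curl (v (-1)) (c s) = 0) →
      ∃ U : Set (EuclideanSpace ℝ (Fin 3)), IsOpen U ∧ U.Nonempty ∧
        ∀ y ∈ U, Literature.Analysis.FluidPDE.curl (v (-1)) y = 0 := by
  intro C v hrate hcont hmild hdiv hpol hne hhot hM hnpv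
  have hs : (-1 : ℝ) < 0 := by norm_num
  have hV :=
    Summit.NavierStokesRegularity.NavierStokesRegularity.Theorems.PoloidalWindowDoorPoloidalWindowRigidityClebsch.contDiff_slice
      hrate hcont hmild hs
  obtain ⟨φ, ψ, hφ, hψ, h0, h1, h2, hvec, hcomp, hcross, hE1, hax⟩ :=
    Summit.NavierStokesRegularity.NavierStokesRegularity.Theorems.PoloidalWindowDoorPoloidalWindowRigidityClebsch.exists_clebsch_slice
      hrate hcont hmild hdiv hpol hs
  have hfi := Summit.NavierStokesRegularity.NavierStokesRegularity.Theorems.PoloidalWindowDoorPoloidalWindowRigidityFirstIntegral.stub_firstIntegral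
    C v hrate hcont hmild hdiv (EuclideanSpace.single 2 1) hpol (-1) hs
  have hbr := fun y =>
    Summit.NavierStokesRegularity.NavierStokesRegularity.Theorems.PoloidalWindowDoorPoloidalWindowRigidityClebsch.frozen_bracket
      (v := v) (s := -1) hfi hcomp y
  have hhot' : ∀ x, |v (-1) x 2| ≤ |v (-1) 0 2| := fun x => by
    have h := hhot (-1) hs x
    simpa using h
  exact planarFirstIntegralGerm (v (-1)) ψ (hV.of_le (by norm_cast)) (hψ.of_le (by norm_cast)) hcomp hbr hne hhot' hM
    hnpv


/-- **A MORSE HOT SPOT IS AN IRROTATIONAL GERM (v3: PROVED from S6 + S7; v1/v2's deciding stub `stub_threadAxis`, same statement).**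
For a profile of the route's Type-I class, poloidal along `e₃`, normalised at the hot spot (`√(−t)|v₂(t,x)| ≤ |v₂(−1,0)| ≠ 0`), threaded there
(`∇v₂(−1,0) = 0`), with the signed pins, and MORSE there, the vorticity vanishes on a nonempty open set of the slice `t = −1`.  The pin and signed-pin
hypotheses are kept for interface stability (unused: S7 needs only the maximum and the Morse condition). -/
theorem threadAxis_of_NPV
    (hNPV :
      ∀ (C : ℝ) (v : ℝ → EuclideanSpace ℝ (Fin 3) → EuclideanSpace ℝ (Fin 3)),
      Literature.Analysis.FluidPDE.HasTypeITimeDecay C v →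
      ContinuousOn (Function.uncurry v) (Set.Iio (0 : ℝ) ×ˢ Set.univ) →
      (∀ s t : ℝ, s < t → t < 0 → ∀ x, v t x =
        Literature.Analysis.UnboundedOperators.heatExtension (v s) (t - s) x -
          Literature.Analysis.FluidPDE.oseenDuhamel 1 s v v t x) →
      (∀ t < 0, Literature.Analysis.FluidPDE.VectorCalculus.IsDivFree (v t)) →
      (∀ s < 0, ∀ y, ⟪Literature.Analysis.FluidPDE.curl (v s) y, EuclideanSpace.single 2 1⟫_ℝ = 0) →
      ∀ t < 0, ∀ (c : ℝ → EuclideanSpace ℝ (Fin 3)) (T : ℝ), 0 < T → Function.Periodic c T →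
        (∀ s, HasDerivAt c (Literature.Analysis.FluidPDE.curl (v t) (c s)) s) →
        ∀ s, Literature.Analysis.FluidPDE.curl (v t) (c s) = 0) :
    ∀ (C : ℝ) (v : ℝ → EuclideanSpace ℝ (Fin 3) → EuclideanSpace ℝ (Fin 3)),
      Literature.Analysis.FluidPDE.HasTypeITimeDecay C v →
      ContinuousOn (Function.uncurry v) (Set.Iio (0 : ℝ) ×ˢ Set.univ) →
      (∀ s t : ℝ, s < t → t < 0 → ∀ x, v t x =
        Literature.Analysis.UnboundedOperators.heatExtension (v s) (t - s) x -
          Literature.Analysis.FluidPDE.oseenDuhamel 1 s v v t x) →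
      (∀ t < 0, Literature.Analysis.FluidPDE.VectorCalculus.IsDivFree (v t)) →
      (∀ s < 0, ∀ y, ⟪Literature.Analysis.FluidPDE.curl (v s) y, EuclideanSpace.single 2 1⟫_ℝ = 0) →
      v (-1) 0 2 ≠ 0 → (∀ t < 0, ∀ x, Real.sqrt (-t) * |v t x 2| ≤ |v (-1) 0 2|) →
      (∀ h : EuclideanSpace ℝ (Fin 3), fderiv ℝ (v (-1)) 0 h 2 = 0) →
      (deriv (fun s => v s 0 2) (-1) = v (-1) 0 2 / 2 ∧ v (-1) 0 2 * (Δ (fun y => v (-1) y 2)) 0 ≤ 0) →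
      (∀ e : EuclideanSpace ℝ (Fin 3), e ≠ 0 → e 2 = 0 →
        fderiv ℝ (fun x => fderiv ℝ (fun y => v (-1) y 2) x e) 0 e ≠ 0) →
      ∃ U : Set (EuclideanSpace ℝ (Fin 3)), IsOpen U ∧ U.Nonempty ∧
        ∀ y ∈ U, Literature.Analysis.FluidPDE.curl (v (-1)) y = 0 :=
  fun C v hrate hcont hmild hdiv hpol hne hhot _hpin _hsp hM =>
    threadGermOfNPV C v hrate hcont hmild hdiv hpol hne hhot hM
      (hNPV C v hrate hcont hmild hdiv hpol (-1) (by norm_num))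

/-- **S5a (time pin; v4: PROVED, formerly half of `stub_threadSignedPin`).**
At the hot spot `(−1, 0)` of `√(−t)|v_z|` over the whole past, the time derivative of `v_z` is PINNED:
`∂ₜ v_z(−1,0) = v_z(−1,0)/2` — Fermat in `t` for `s ↦ √(−s)·σ·v_z(s,0)` (`σ = sign v_z(−1,0)`), time-differentiability
from the joint analyticity of the class (`analyticOnNhd_uncurry`). -/
theorem threadTimePin {v : ℝ → EuclideanSpace ℝ (Fin 3) → EuclideanSpace ℝ (Fin 3)} {C : ℝ}
    (hrate : HasTypeITimeDecay C v)
    (hcont : ContinuousOn (uncurry v) (Iio (0 : ℝ) ×ˢ univ))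
    (hmild : ∀ s t : ℝ, s < t → t < 0 → ∀ x, v t x = UnboundedOperators.heatExtension (v s) (t - s) x - oseenDuhamel 1 s v v t x)
    (hne : v (-1) 0 2 ≠ 0) (hhot : ∀ t < 0, ∀ x, Real.sqrt (-t) * |v t x 2| ≤ |v (-1) 0 2|) :
    deriv (fun s => v s 0 2) (-1) = v (-1) 0 2 / 2 := by
  -- time-differentiability of `s ↦ v_z(s,0)` at `s = −1`
  have han := analyticOnNhd_uncurry hcont (bdd_of_hasTypeITimeDecay hrate) hmild
  have hmem : ((-1 : ℝ), (0 : EuclideanSpace ℝ (Fin 3))) ∈ Iio (0 : ℝ) ×ˢ (univ : Set (EuclideanSpace ℝ (Fin 3))) :=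
    mem_prod.2 ⟨by norm_num, mem_univ _⟩
  have hA : AnalyticAt ℝ (uncurry v) ((-1 : ℝ), (0 : EuclideanSpace ℝ (Fin 3))) := han _ hmem
  have h1 : DifferentiableAt ℝ (fun s : ℝ => (s, (0 : EuclideanSpace ℝ (Fin 3)))) (-1) :=
    differentiableAt_id.prodMk (differentiableAt_const _)
  have h2 : DifferentiableAt ℝ (uncurry v ∘ fun s : ℝ => (s, (0 : EuclideanSpace ℝ (Fin 3)))) (-1) :=
    hA.differentiableAt.comp (-1) h1
  have hfd : DifferentiableAt ℝ (fun s => v s 0 2) (-1) :=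
    ((EuclideanSpace.proj (𝕜 := ℝ) (2 : Fin 3)).differentiableAt).comp (-1) h2
  -- the sign `σ` of `v_z(−1,0)`
  obtain ⟨σ, hσabs, hσa⟩ : ∃ σ : ℝ, |σ| = 1 ∧ σ * v (-1) 0 2 = |v (-1) 0 2| := by
    rcases lt_or_gt_of_ne hne with h | h
    · exact ⟨-1, by simp, by rw [abs_of_neg h]; ring⟩
    · exact ⟨1, by simp, by rw [abs_of_pos h]; ring⟩
  have hσle : ∀ y : ℝ, σ * y ≤ |y| := fun y =>
    calc σ * y ≤ |σ * y| := le_abs_self _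
      _ = |y| := by rw [abs_mul, hσabs, one_mul]
  have hσne : σ ≠ 0 := fun h0 => by rw [h0, abs_zero] at hσabs; exact zero_ne_one hσabs
  -- `g(s) = √(−s)·σ·v_z(s,0)` has a local maximum at `s = −1`
  have hgmax : IsLocalMax (fun s : ℝ => Real.sqrt (-s) * (σ * v s 0 2)) (-1) := by
    have hnhds : ∀ᶠ s in 𝓝 (-1 : ℝ), s < 0 := Iio_mem_nhds (by norm_num)
    filter_upwards [hnhds] with s hs
    have hR : Real.sqrt (-(-1 : ℝ)) = 1 := by norm_num
    rw [hR, one_mul]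
    calc Real.sqrt (-s) * (σ * v s 0 2) ≤ Real.sqrt (-s) * |v s 0 2| :=
          mul_le_mul_of_nonneg_left (hσle _) (Real.sqrt_nonneg _)
      _ ≤ |v (-1) 0 2| := hhot s hs 0
      _ = σ * v (-1) 0 2 := hσa.symm
  have hderiv0 := hgmax.deriv_eq_zero
  -- product rule at `s = −1`
  have hsqrt : HasDerivAt (fun s : ℝ => Real.sqrt (-s)) (1 / (2 * Real.sqrt (-(-1 : ℝ))) * (-1)) (-1) := by
    have hneg : HasDerivAt (fun s : ℝ => -s) (-1) (-1) := hasDerivAt_neg (-1 : ℝ)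
    have hs : HasDerivAt Real.sqrt (1 / (2 * Real.sqrt (-(-1 : ℝ)))) (-(-1 : ℝ)) :=
      Real.hasDerivAt_sqrt (by norm_num)
    exact hs.comp (-1) hneg
  have hg' := hsqrt.mul (hfd.hasDerivAt.const_mul σ)
  have hzero := hg'.deriv.symm.trans hderiv0
  have hR : Real.sqrt (-(-1 : ℝ)) = 1 := by norm_num
  rw [hR] at hzero
  have hkey : σ * (deriv (fun s => v s 0 2) (-1) - v (-1) 0 2 / 2) = 0 := by linear_combination hzero
  rcases mul_eq_zero.1 hkey with h0 | h0
  · exact absurd h0 hσne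
  · linarith

/-- 1-D necessity half of the second-derivative test: a `C²` function with a local maximum at `0` has `φ″(0) ≤ 0`. -/
theorem deriv2_nonpos_of_isLocalMax {φ : ℝ → ℝ} (hφ : ContDiff ℝ 2 φ) (hmax : IsLocalMax φ 0) :
    deriv (deriv φ) 0 ≤ 0 := by
  by_contra hpos
  push Not at hpos
  have hd1 : deriv φ 0 = 0 := hmax.deriv_eq_zero
  have hsign := eventually_nhdsWithin_sign_eq_of_deriv_pos hpos hd1
  obtain ⟨ε, hε, hball⟩ := Metric.eventually_nhds_iff.1 (hsign.and hmax)
  have hdiff : Differentiable ℝ φ := hφ.differentiable (by norm_num)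
  have hpos' : ∀ x : ℝ, 0 < x → x < ε → 0 < deriv φ x := by
    intro x hx0 hxε
    have hx : dist x 0 < ε := by rw [Real.dist_eq, sub_zero, abs_of_pos hx0]; exact hxε
    have h := (hball hx).1
    rw [sub_zero, sign_pos hx0, sign_eq_one_iff] at h
    exact h
  obtain ⟨c, hc, hcd⟩ := exists_deriv_eq_slope φ (by linarith : (0 : ℝ) < ε / 2)
    hdiff.continuous.continuousOn (hdiff.differentiableOn)
  have h1 : 0 < deriv φ c := hpos' c hc.1 (by linarith [hc.2])
  have hε2 : dist (ε / 2) 0 < ε := by rw [Real.dist_eq, sub_zero, abs_of_pos (by linarith)]; linarith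
  have h2 : φ (ε / 2) ≤ φ 0 := (hball hε2).2
  rw [hcd, sub_zero] at h1
  have h3 : 0 < φ (ε / 2) - φ 0 := (div_pos_iff_of_pos_right (by linarith)).1 h1
  linarith

/-- The second derivative of a `C²` function along a line is the second Fréchet derivative on the diagonal. -/
theorem deriv2_line_eq_iteratedFDeriv {f : EuclideanSpace ℝ (Fin 3) → ℝ} (hf : ContDiff ℝ 2 f)
    (x w : EuclideanSpace ℝ (Fin 3)) :
    deriv (deriv (fun t : ℝ => f (x + t • w))) 0 = iteratedFDeriv ℝ 2 f x ![w, w] := by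
  have hd : Differentiable ℝ f := hf.differentiable (by norm_num)
  have hd2 : Differentiable ℝ (fderiv ℝ f) :=
    (hf.fderiv_right (m := 1) (by norm_num)).differentiable one_ne_zero
  have hline : ∀ t : ℝ, HasDerivAt (fun t : ℝ => x + t • w) w t := fun t => by
    simpa using ((hasDerivAt_id t).smul_const w).const_add x
  have h1 : ∀ t : ℝ, HasDerivAt (fun t : ℝ => f (x + t • w)) (fderiv ℝ f (x + t • w) w) t := fun t =>
    (hd (x + t • w)).hasFDerivAt.comp_hasDerivAt t (hline t)
  have h1' : deriv (fun t : ℝ => f (x + t • w)) = fun t => fderiv ℝ f (x + t • w) w :=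
    funext fun t => (h1 t).deriv
  rw [h1']
  have hc : HasDerivAt (fun t : ℝ => fderiv ℝ f (x + t • w)) (fderiv ℝ (fderiv ℝ f) (x + (0 : ℝ) • w) w) 0 :=
    (hd2 (x + (0 : ℝ) • w)).hasFDerivAt.comp_hasDerivAt (0 : ℝ) (hline 0)
  have h2 := hc.clm_apply (hasDerivAt_const (0 : ℝ) w)
  rw [h2.deriv, iteratedFDeriv_two_apply]
  simp

/-- **S5b (space pin; v4: PROVED, formerly the Laplacian half of `stub_threadSignedPin`).**
At the hot spot `(−1,0)`, `v_z(−1,·)` attains `max |v_z(−1,·)|` at `0` (the weight `√(−t)` is `1` at `t = −1`), so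
`v_z(−1,0) · Δ v_z(−1,·)(0) ≤ 0` — each pure second derivative of `σ·v_z(−1,·)` along a line through `0` is `≤ 0`
(1-D necessity) and the Laplacian is their sum over an orthonormal basis; `C²` from the slice analyticity of the class. -/
theorem threadSpacePin {v : ℝ → EuclideanSpace ℝ (Fin 3) → EuclideanSpace ℝ (Fin 3)} {C : ℝ}
    (hrate : HasTypeITimeDecay C v)
    (hcont : ContinuousOn (uncurry v) (Iio (0 : ℝ) ×ˢ univ))
    (hmild : ∀ s t : ℝ, s < t → t < 0 → ∀ x, v t x = UnboundedOperators.heatExtension (v s) (t - s) x - oseenDuhamel 1 s v v t x)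
    (hne : v (-1) 0 2 ≠ 0) (hhot : ∀ t < 0, ∀ x, Real.sqrt (-t) * |v t x 2| ≤ |v (-1) 0 2|) :
    v (-1) 0 2 * (Δ (fun y => v (-1) y 2)) 0 ≤ 0 := by
  set f : EuclideanSpace ℝ (Fin 3) → ℝ := fun y => v (-1) y 2 with hf
  have hfa : ContDiff ℝ 2 f := by
    have hsl := analyticOnNhd_slice hcont (bdd_of_hasTypeITimeDecay hrate) hmild (by norm_num : (-1 : ℝ) < 0)
    have han : AnalyticOnNhd ℝ f univ := fun y _ =>
      ((EuclideanSpace.proj (𝕜 := ℝ) (2 : Fin 3)).analyticAt _).comp (hsl y (mem_univ _))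
    exact han.contDiff
  obtain ⟨σ, hσabs, hσa⟩ : ∃ σ : ℝ, |σ| = 1 ∧ σ * v (-1) 0 2 = |v (-1) 0 2| := by
    rcases lt_or_gt_of_ne hne with h | h
    · exact ⟨-1, by simp, by rw [abs_of_neg h]; ring⟩
    · exact ⟨1, by simp, by rw [abs_of_pos h]; ring⟩
  have hσle : ∀ y : ℝ, σ * y ≤ |y| := fun y =>
    calc σ * y ≤ |σ * y| := le_abs_self _
      _ = |y| := by rw [abs_mul, hσabs, one_mul]
  have hσ2 : σ * σ = 1 := by
    have h := congrArg (fun r : ℝ => r ^ 2) hσabs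
    simp only [sq_abs, one_pow] at h
    nlinarith [h]
  -- every pure second derivative of `σ f` through `0` is `≤ 0`
  have hw : ∀ w : EuclideanSpace ℝ (Fin 3), σ * iteratedFDeriv ℝ 2 f 0 ![w, w] ≤ 0 := by
    intro w
    have hφc : ContDiff ℝ 2 (fun t : ℝ => σ * f (0 + t • w)) :=
      contDiff_const.mul (hfa.comp (contDiff_const.add (contDiff_id.smul contDiff_const)))
    have hmax : IsLocalMax (fun t : ℝ => σ * f (0 + t • w)) 0 := by
      refine Filter.Eventually.of_forall fun t => ?_
      show σ * f (0 + t • w) ≤ σ * f (0 + (0 : ℝ) • w)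
      simp only [zero_smul, add_zero, zero_add]
      have hh := hhot (-1) (by norm_num) (t • w)
      have hR : Real.sqrt (-(-1 : ℝ)) = 1 := by norm_num
      rw [hR, one_mul] at hh
      calc σ * f (t • w) ≤ |f (t • w)| := hσle _
        _ ≤ |v (-1) 0 2| := hh
        _ = σ * f 0 := hσa.symm
    have hA := deriv2_nonpos_of_isLocalMax hφc hmax
    have hB : deriv (deriv (fun t : ℝ => σ * f (0 + t • w))) 0 = σ * iteratedFDeriv ℝ 2 f 0 ![w, w] := by
      rw [← deriv2_line_eq_iteratedFDeriv hfa 0 w]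
      have e1 : deriv (fun t : ℝ => σ * f (0 + t • w)) = fun t => σ * deriv (fun t : ℝ => f (0 + t • w)) t :=
        deriv_const_mul_field' σ
      rw [e1, deriv_const_mul_field']
    rw [hB] at hA
    exact hA
  rw [InnerProductSpace.laplacian_eq_iteratedFDeriv_orthonormalBasis f (EuclideanSpace.basisFun (Fin 3) ℝ)]
  have hS : σ * ∑ i, iteratedFDeriv ℝ 2 f 0
      ![(EuclideanSpace.basisFun (Fin 3) ℝ) i, (EuclideanSpace.basisFun (Fin 3) ℝ) i] ≤ 0 := by
    rw [Finset.mul_sum]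
    exact Finset.sum_nonpos fun i _ => hw _
  have haσ : v (-1) 0 2 = |v (-1) 0 2| * σ := by
    calc v (-1) 0 2 = (σ * σ) * v (-1) 0 2 := by rw [hσ2, one_mul]
      _ = (σ * v (-1) 0 2) * σ := by ring
      _ = |v (-1) 0 2| * σ := by rw [hσa]
  rw [haσ, mul_assoc]
  exact mul_nonpos_of_nonneg_of_nonpos (abs_nonneg _) hS

/-- **S5 — THE SIGNED PINS (v4: PROVED, sorry-free; was `stub_threadSignedPin`, provable M; answers critic price P2 on `far_thread` — first typed contact with (M) at the hot spot).**
For a profile of the route's Type-I class normalised at the hot spot (`√(−t)|v₂(t,x)| ≤ |v₂(−1,0)| ≠ 0`): the interior time-maximum of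
`t ↦ √(−t) v₂(t,0) sgn v₂(−1,0)` at `t = −1` gives `∂ₜv₂(−1,0) = v₂(−1,0)/2` EXACTLY, and the spatial maximum of `x ↦ v₂(−1,x) sgn v₂(−1,0)` at `0` gives
`v₂(−1,0)·Δv₂(−1,0) ≤ 0`; hence the signed pin `v₂·(∂ₜ − Δ)v₂ (−1,0) ≥ v₂(−1,0)²/2 > 0` (one line of algebra from the two conjuncts), i.e. with (M) read
pointwise (`∂ₜw + v·∇w − Δw = −∂_z p`, transport killed by the PROVED thread pin) `v₂·∂_z p(−1,0) ≤ −v₂²/2 < 0`.  PROOF (v4): joint real-analyticity of the class on the open slab (`analyticOnNhd_uncurry` / `analyticOnNhd_slice`) ⇒ `deriv`/`Δ` classical; Fermat in `t`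
for `s ↦ √(−s)σv₂(s,0)` (`threadTimePin`); 1-D necessity `φ″(0) ≤ 0` at a local max (`deriv2_nonpos_of_isLocalMax`) along every line through `0`, second line-derivative =
`iteratedFDeriv ℝ 2` on the diagonal (`deriv2_line_eq_iteratedFDeriv`), `Δ = Σᵢ D²f[eᵢ,eᵢ]` over an orthonormal basis (`threadSpacePin`).  No poloidality needed. -/
theorem threadSignedPin :
    ∀ (C : ℝ) (v : ℝ → EuclideanSpace ℝ (Fin 3) → EuclideanSpace ℝ (Fin 3)),
      Literature.Analysis.FluidPDE.HasTypeITimeDecay C v →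
      ContinuousOn (Function.uncurry v) (Set.Iio (0 : ℝ) ×ˢ Set.univ) →
      (∀ s t : ℝ, s < t → t < 0 → ∀ x, v t x =
        Literature.Analysis.UnboundedOperators.heatExtension (v s) (t - s) x -
          Literature.Analysis.FluidPDE.oseenDuhamel 1 s v v t x) →
      (∀ t < 0, Literature.Analysis.FluidPDE.VectorCalculus.IsDivFree (v t)) →
      v (-1) 0 2 ≠ 0 → (∀ t < 0, ∀ x, Real.sqrt (-t) * |v t x 2| ≤ |v (-1) 0 2|) →
      (deriv (fun s => v s 0 2) (-1) = v (-1) 0 2 / 2 ∧ v (-1) 0 2 * (Δ (fun y => v (-1) y 2)) 0 ≤ 0) :=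
  fun C v hrate hcont hmild _ hne hhot =>
    ⟨threadTimePin hrate hcont hmild hne hhot, threadSpacePin hrate hcont hmild hne hhot⟩

/-! ## Proved: the hot spot is a thread -/

/-- Component of a derivative = derivative of the component. -/
theorem fderiv_apply_coord (u : EuclideanSpace ℝ (Fin 3) → EuclideanSpace ℝ (Fin 3)) {x : EuclideanSpace ℝ (Fin 3)}
    (hu : DifferentiableAt ℝ u x) (h : EuclideanSpace ℝ (Fin 3)) (i : Fin 3) :
    fderiv ℝ (fun z => u z i) x h = fderiv ℝ u x h i := by
  have hc := ((EuclideanSpace.proj (𝕜 := ℝ) i).hasFDerivAt.comp x hu.hasFDerivAt).fderiv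
  have hfun : (fun z => u z i) = (EuclideanSpace.proj (𝕜 := ℝ) i) ∘ u := rfl
  rw [hfun, hc]
  rfl

/-- **THE HOT SPOT IS A THREAD (proved).**  Under the normalisation of `stub_extremalThread` the slice `v(−1)` has `∇v₂(0) = 0`:
`|v₂(−1,·)|` attains a global maximum at `0`, and the slice is differentiable (real-analytic, tree `analyticOnNhd_slice`). -/
theorem threadPin_of_hotSpot {C : ℝ} {v : ℝ → EuclideanSpace ℝ (Fin 3) → EuclideanSpace ℝ (Fin 3)}
    (hrate : Literature.Analysis.FluidPDE.HasTypeITimeDecay C v)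
    (hcont : ContinuousOn (Function.uncurry v) (Set.Iio (0 : ℝ) ×ˢ Set.univ))
    (hmild : ∀ s t : ℝ, s < t → t < 0 → ∀ x, v t x =
      Literature.Analysis.UnboundedOperators.heatExtension (v s) (t - s) x -
        Literature.Analysis.FluidPDE.oseenDuhamel 1 s v v t x)
    (hhot : ∀ t < 0, ∀ x, Real.sqrt (-t) * |v t x 2| ≤ |v (-1) 0 2|) :
    ∀ h : EuclideanSpace ℝ (Fin 3), fderiv ℝ (v (-1)) 0 h 2 = 0 := by
  have hs : (-1 : ℝ) < 0 := by norm_num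
  have hA : AnalyticOnNhd ℝ (v (-1)) Set.univ := analyticOnNhd_slice hcont (bdd_of_hasTypeITimeDecay hrate) hmild hs
  have hd : DifferentiableAt ℝ (v (-1)) 0 := (hA 0 (Set.mem_univ _)).differentiableAt
  set f : EuclideanSpace ℝ (Fin 3) → ℝ := fun x => v (-1) x 2 with hf
  have hfd : DifferentiableAt ℝ f 0 := by
    have := ((EuclideanSpace.proj (𝕜 := ℝ) (2 : Fin 3)).hasFDerivAt.comp (0 : EuclideanSpace ℝ (Fin 3)) hd.hasFDerivAt)
    exact this.differentiableAt
  have hbound : ∀ x, |f x| ≤ |f 0| := by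
    intro x
    have h1 := hhot (-1) hs x
    simpa using h1
  -- `fderiv f 0 = 0`: global max of `f` (if `f 0 ≥ 0`) or global min (if `f 0 ≤ 0`)
  have hcrit : fderiv ℝ f 0 = 0 := by
    rcases le_total 0 (f 0) with h0 | h0
    · have hmax : IsLocalMax f 0 := by
        refine Filter.Eventually.of_forall fun x => ?_
        have := hbound x
        rw [abs_of_nonneg h0] at this
        exact (le_abs_self (f x)).trans this
      exact hmax.fderiv_eq_zero
    · have hmin : IsLocalMin f 0 := by
        refine Filter.Eventually.of_forall fun x => ?_
        have := hbound x
        rw [abs_of_nonpos h0] at this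
        have := (neg_le_abs (f x)).trans this
        linarith
      exact hmin.fderiv_eq_zero
  intro h
  have := fderiv_apply_coord (v (-1)) hd h 2
  rw [← this]
  simp [hf.symm ▸ hcrit]

/-! ## Composition, step 1 (proved): the (TH) column in LIOUVILLE currency from the shared local stub (= `twist_split` v4.3's chain) -/

/-- v4.1's local statement from the v4.3 stub (rotation/scaling gauge, Galilean frame and non-umbilic relocation are free:
`…NormalFormRS.localTHEmptyHypNF_of_normalFormRS`, `…Galilean.localTHEmptyHypNonUmbilic_of_galilean`,
`…NonUmbilic.localTHEmptyHyp_of_localTHEmptyHypNonUmbilic`). -/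
theorem localTHEmptyHyp_of_stubNUGRS :
    ∀ (u : ℝ → EuclideanSpace ℝ (Fin 3) → EuclideanSpace ℝ (Fin 3)) (μ A : ℝ → ℝ → ℝ)
      (U : Set (ℝ × EuclideanSpace ℝ (Fin 3))) (p₀ : ℝ × EuclideanSpace ℝ (Fin 3)),
      IsOpen U → p₀ ∈ U →
      AnalyticOnNhd ℝ (Function.uncurry u) U →
      (∀ p ∈ U, AnalyticAt ℝ (Function.uncurry μ) (p.1, p.2 2)) →
      (∀ p ∈ U, AnalyticAt ℝ (Function.uncurry A) (p.1, p.2 2)) →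
      (∀ p ∈ U, fderiv ℝ (u p.1) p.2 (EuclideanSpace.single 0 1) 1 = fderiv ℝ (u p.1) p.2 (EuclideanSpace.single 1 1) 0) →
      (∀ p ∈ U, fderiv ℝ (u p.1) p.2 (EuclideanSpace.single 0 1) 0 + fderiv ℝ (u p.1) p.2 (EuclideanSpace.single 1 1) 1 +
        fderiv ℝ (u p.1) p.2 (EuclideanSpace.single 2 1) 2 = 0) →
      (∀ p ∈ U, ∀ b : Fin 3, b ≠ 2 →
        fderiv ℝ (u p.1) p.2 (EuclideanSpace.single 2 1) b =
          μ p.1 (p.2 2) * fderiv ℝ (u p.1) p.2 (EuclideanSpace.single b 1) 2) →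
      (∀ p ∈ U,
        (1 - μ p.1 (p.2 2)) *
            (deriv (fun s => u s p.2 2) p.1 + fderiv ℝ (fun y => u p.1 y 2) p.2 (u p.1 p.2)
              - Δ (fun y => u p.1 y 2) p.2) =
          A p.1 (p.2 2) + (deriv (fun s => μ s (p.2 2)) p.1 - deriv (deriv (μ p.1)) (p.2 2)) * u p.1 p.2 2
            + deriv (μ p.1) (p.2 2) / 2 * u p.1 p.2 2 ^ 2
            - 2 * deriv (μ p.1) (p.2 2) * fderiv ℝ (u p.1) p.2 (EuclideanSpace.single 2 1) 2) →
      fderiv ℝ (fun y => fderiv ℝ (u p₀.1) y (EuclideanSpace.single 2 1) 2) p₀.2 (EuclideanSpace.single 0 1) *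
            fderiv ℝ (u p₀.1) p₀.2 (EuclideanSpace.single 1 1) 2 -
          fderiv ℝ (fun y => fderiv ℝ (u p₀.1) y (EuclideanSpace.single 2 1) 2) p₀.2 (EuclideanSpace.single 1 1) *
            fderiv ℝ (u p₀.1) p₀.2 (EuclideanSpace.single 0 1) 2 ≠ 0 →
      μ p₀.1 (p₀.2 2) ≠ 0 → μ p₀.1 (p₀.2 2) ≠ 1 → deriv (μ p₀.1) (p₀.2 2) ≠ 0 →
      μ p₀.1 (p₀.2 2) < 0 → False :=
  localTHEmptyHyp_of_localTHEmptyHypNonUmbilic (localTHEmptyHypNonUmbilic_of_galilean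
    (localTHEmptyHypNF_of_normalFormRS stub_localTHEmptyHypNUGRS))

/-- **(TH)∩TWISTING ⇒ the germ trichotomy** — tree `…TwistingTHLocalHypGerm.stub_twistingTH_of_localEmptyHyp` fed with the local stub
(= `twist_split`'s `stub_twistingTH`, same term). -/
theorem twistingTH_germ :
    ∀ (C : ℝ) (v : ℝ → EuclideanSpace ℝ (Fin 3) → EuclideanSpace ℝ (Fin 3)),
      Literature.Analysis.FluidPDE.HasTypeITimeDecay C v →
      ContinuousOn (Function.uncurry v) (Set.Iio (0 : ℝ) ×ˢ Set.univ) →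
      (∀ s t : ℝ, s < t → t < 0 → ∀ x, v t x =
        Literature.Analysis.UnboundedOperators.heatExtension (v s) (t - s) x -
          Literature.Analysis.FluidPDE.oseenDuhamel 1 s v v t x) →
      (∀ t < 0, Literature.Analysis.FluidPDE.VectorCalculus.IsDivFree (v t)) →
      (∀ s < 0, ∀ y, ⟪Literature.Analysis.FluidPDE.curl (v s) y, EuclideanSpace.single 2 1⟫_ℝ = 0) →
      ∀ W : Set (ℝ × EuclideanSpace ℝ (Fin 3)), IsOpen W → W.Nonempty → W ⊆ Set.Iio (0 : ℝ) ×ˢ Set.univ →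
        (∀ z ∈ W, (Literature.Analysis.FluidPDE.curl (v z.1) z.2 ≠ 0 ∧
            (fderiv ℝ (v z.1) z.2 (EuclideanSpace.single 0 1) 2 ≠ 0 ∨ fderiv ℝ (v z.1) z.2 (EuclideanSpace.single 1 1) 2 ≠ 0) ∧
            (fderiv ℝ (v z.1) z.2 (EuclideanSpace.single 2 1) 0 ≠ 0 ∨ fderiv ℝ (v z.1) z.2 (EuclideanSpace.single 2 1) 1 ≠ 0))) →
        (∀ m : ℝ → ℝ, ∀ W₁ : Set (ℝ × EuclideanSpace ℝ (Fin 3)), W₁ ⊆ W → IsOpen W₁ → W₁.Nonempty →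
            ∃ z ∈ W₁, ∃ b : Fin 3, b ≠ 2 ∧
              fderiv ℝ (v z.1) z.2 (EuclideanSpace.single 2 1) b ≠
                m z.1 * fderiv ℝ (v z.1) z.2 (EuclideanSpace.single b 1) 2) →
        (∀ z ∈ W, (fderiv ℝ (fun x => fderiv ℝ (v z.1) x (EuclideanSpace.single 2 1) 2) z.2 (EuclideanSpace.single 0 1) *
                fderiv ℝ (v z.1) z.2 (EuclideanSpace.single 1 1) 2 -
              fderiv ℝ (fun x => fderiv ℝ (v z.1) x (EuclideanSpace.single 2 1) 2) z.2 (EuclideanSpace.single 1 1) *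
                fderiv ℝ (v z.1) z.2 (EuclideanSpace.single 0 1) 2 ≠ 0)) →
        (∃ m : ℝ → ℝ → ℝ, ∀ z ∈ W, ∀ b : Fin 3, b ≠ 2 →
            fderiv ℝ (v z.1) z.2 (EuclideanSpace.single 2 1) b =
              m z.1 (z.2 2) * fderiv ℝ (v z.1) z.2 (EuclideanSpace.single b 1) 2) →
        ∃ s : ℝ, s < 0 ∧ ∃ U : Set (EuclideanSpace ℝ (Fin 3)), IsOpen U ∧ U.Nonempty ∧
          ((∃ e : EuclideanSpace ℝ (Fin 3), e ≠ 0 ∧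
              ∀ y ∈ U, fderiv ℝ (Literature.Analysis.FluidPDE.curl (v s)) y e = 0) ∨
           (∃ c : EuclideanSpace ℝ (Fin 3), ∀ y ∈ U,
              Literature.Analysis.FluidPDE.rotGen (Literature.Analysis.FluidPDE.curl (v s) y) =
                fderiv ℝ (Literature.Analysis.FluidPDE.curl (v s)) y (Literature.Analysis.FluidPDE.rotGen (y - c))) ∨
           (∃ w : EuclideanSpace ℝ (Fin 3) → EuclideanSpace ℝ (Fin 3), AnalyticOnNhd ℝ w Set.univ ∧
              ¬ BddAbove (Set.range fun y => ‖w y‖) ∧ ∀ y ∈ U, v s y = w y)) :=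
  stub_twistingTH_of_localEmptyHyp localTHEmptyHyp_of_stubNUGRS

/-! ## Composition, step 2 (proved): the (TV) column in LIOUVILLE currency (tree) -/

/-- **Time-only slope on SOME window ⇒ `v ≡ 0`** — `…TimeShearPressure.timeShear_normalForm` + the slope dichotomy
`…TimeShearLiminf.eq_zero_of_timeShear_liminf` / `…HorizontalFlatPast.eq_zero_of_timeShear_unbounded` (the `eq_zero` halves of
`…TimeShearClosed.nonflatLiouville_of_local_timeShear`). -/
theorem eq_zero_of_local_timeOnlySlope {C : ℝ} {v : ℝ → EuclideanSpace ℝ (Fin 3) → EuclideanSpace ℝ (Fin 3)}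
    (hrate : Literature.Analysis.FluidPDE.HasTypeITimeDecay C v)
    (hcont : ContinuousOn (Function.uncurry v) (Set.Iio (0 : ℝ) ×ˢ Set.univ))
    (hmild : ∀ s t : ℝ, s < t → t < 0 → ∀ x, v t x =
      Literature.Analysis.UnboundedOperators.heatExtension (v s) (t - s) x -
        Literature.Analysis.FluidPDE.oseenDuhamel 1 s v v t x)
    (hdiv : ∀ t < 0, Literature.Analysis.FluidPDE.VectorCalculus.IsDivFree (v t))
    (hpol : ∀ s < 0, ∀ y, ⟪Literature.Analysis.FluidPDE.curl (v s) y, EuclideanSpace.single 2 1⟫_ℝ = 0)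
    {W : Set (ℝ × EuclideanSpace ℝ (Fin 3))} (hW : IsOpen W) (hWne : W.Nonempty) (hWs : W ⊆ Set.Iio (0 : ℝ) ×ˢ Set.univ)
    {m : ℝ → ℝ}
    (h : ∀ z ∈ W, ∀ b : Fin 3, b ≠ 2 →
      fderiv ℝ (v z.1) z.2 (EuclideanSpace.single 2 1) b = m z.1 * fderiv ℝ (v z.1) z.2 (EuclideanSpace.single b 1) 2) :
    ∀ t < 0, ∀ x, v t x = 0 := by
  rcases timeShear_normalForm hrate hcont hmild hdiv hpol hW hWne hWs h with hzero | ⟨μ, hμneg, hμa, hslope⟩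
  · exact hzero
  · by_cases hB : ∃ M : ℝ, ∀ T : ℝ, ∃ τ < T, -M ≤ μ τ
    · obtain ⟨M, hM⟩ := hB
      exact eq_zero_of_timeShear_liminf hrate hcont hmild hdiv hpol hμneg hslope hμa hM
    · push Not at hB
      refine eq_zero_of_timeShear_unbounded hrate hcont hmild hdiv hpol hslope fun M => ?_
      obtain ⟨T, hT⟩ := hB M
      refine ⟨T, fun τ hτ => ?_⟩
      have h1 : μ τ < -M := hT τ hτ
      have h2 : M < -μ τ := by linarith
      exact h2.le.trans (neg_le_abs (μ τ))

/-! ## Composition, step 3 (proved): THE POLOIDAL LIOUVILLE THEOREM from the stubs -/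

/-- **CLASS + POLOIDAL ⇒ `v ≡ 0`** (modulo `stub_extremalThread`, `stub_frequencyGrowthExponent` + `morseLevelPackage_landed` (v10: `slavedOnLevelCircle` is proved; via `planarFirstIntegralGerm`, `periodFloorYorke` (tree), `noPeriodicVortexLine`, `threadGermOfNPV`, `threadAxis_of_NPV`), and on the non-Morse residue `stub_threadDichotomy`,
`stub_threadedThickEmptyFlat`, `stub_localTHEmptyHypNUGRS`).  If `v₂ ≡ 0` the profile is horizontally flat (tree); otherwise recentre at the hot
spot (S1); a MORSE hot spot is an irrotational germ (S4) hence `v' ≡ 0` (tree); a non-Morse hot spot is sorted by S2: flat-threaded thick is S3′,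
the untwisted / (TH) cases give a vorticity germ hence `v' ≡ 0` (tree + shared stub), the time-only and degenerate cases give `v' ≡ 0` (tree) — all
contradicting `v'₂(−1,0) ≠ 0`. -/
theorem poloidalLiouville_of_threadAxis
    (hNPV :
      ∀ (C : ℝ) (v : ℝ → EuclideanSpace ℝ (Fin 3) → EuclideanSpace ℝ (Fin 3)),
      Literature.Analysis.FluidPDE.HasTypeITimeDecay C v →
      ContinuousOn (Function.uncurry v) (Set.Iio (0 : ℝ) ×ˢ Set.univ) →
      (∀ s t : ℝ, s < t → t < 0 → ∀ x, v t x =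
        Literature.Analysis.UnboundedOperators.heatExtension (v s) (t - s) x -
          Literature.Analysis.FluidPDE.oseenDuhamel 1 s v v t x) →
      (∀ t < 0, Literature.Analysis.FluidPDE.VectorCalculus.IsDivFree (v t)) →
      (∀ s < 0, ∀ y, ⟪Literature.Analysis.FluidPDE.curl (v s) y, EuclideanSpace.single 2 1⟫_ℝ = 0) →
      ∀ t < 0, ∀ (c : ℝ → EuclideanSpace ℝ (Fin 3)) (T : ℝ), 0 < T → Function.Periodic c T →
        (∀ s, HasDerivAt c (Literature.Analysis.FluidPDE.curl (v t) (c s)) s) →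
        ∀ s, Literature.Analysis.FluidPDE.curl (v t) (c s) = 0) :
    ∀ (C : ℝ) (v : ℝ → EuclideanSpace ℝ (Fin 3) → EuclideanSpace ℝ (Fin 3)),
      Literature.Analysis.FluidPDE.HasTypeITimeDecay C v →
      ContinuousOn (Function.uncurry v) (Set.Iio (0 : ℝ) ×ˢ Set.univ) →
      (∀ s t : ℝ, s < t → t < 0 → ∀ x, v t x =
        Literature.Analysis.UnboundedOperators.heatExtension (v s) (t - s) x -
          Literature.Analysis.FluidPDE.oseenDuhamel 1 s v v t x) →
      (∀ t < 0, Literature.Analysis.FluidPDE.VectorCalculus.IsDivFree (v t)) →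
      (∀ s < 0, ∀ y, ⟪Literature.Analysis.FluidPDE.curl (v s) y, EuclideanSpace.single 2 1⟫_ℝ = 0) →
      ∀ t < 0, ∀ x, v t x = 0 := by
  intro C v hrate hcont hmild hdiv hpol
  by_cases hv2 : ∀ t < 0, ∀ y : EuclideanSpace ℝ (Fin 3), v t y 2 = 0
  · -- `v₂ ≡ 0`: the slice `−1` is horizontally flat
    have hs : (-1 : ℝ) < 0 := by norm_num
    have hA : AnalyticOnNhd ℝ (v (-1)) Set.univ := analyticOnNhd_slice hcont (bdd_of_hasTypeITimeDecay hrate) hmild hs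
    refine eq_zero_of_horizontalGradient_eq_zero_on_open hrate hcont hmild hdiv hs (hpol (-1) hs) isOpen_univ Set.univ_nonempty ?_
    intro y _
    have hd : DifferentiableAt ℝ (v (-1)) y := (hA y (Set.mem_univ _)).differentiableAt
    have hfun : (fun z => v (-1) z 2) = fun _ => (0 : ℝ) := funext fun z => hv2 (-1) hs z
    have h1 : fderiv ℝ (fun z => v (-1) z 2) y (EuclideanSpace.single 0 1) = 0 := by
      rw [hfun]; simp
    rw [fderiv_apply_coord (v (-1)) hd] at h1
    exact h1
  · push Not at hv2
    obtain ⟨t₀, ht₀, y₀, hy₀⟩ := hv2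
    exfalso
    obtain ⟨v', hrate', hcont', hmild', hdiv', hpol', hne, hhot⟩ :=
      stub_extremalThread C v hrate hcont hmild hdiv hpol ⟨t₀, ht₀, y₀, hy₀⟩
    have hs : (-1 : ℝ) < 0 := by norm_num
    -- `v' ≡ 0` is absurd
    have habs : ¬ (∀ t < 0, ∀ x, v' t x = 0) := fun h0 => hne (by rw [h0 (-1) hs 0]; rfl)
    -- germ ⇒ absurd
    have hgermAbs : ∀ (W : Set (ℝ × EuclideanSpace ℝ (Fin 3))), W.Nonempty → W ⊆ Set.Iio (0 : ℝ) ×ˢ Set.univ →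
        (∀ z ∈ W, Literature.Analysis.FluidPDE.curl (v' z.1) z.2 ≠ 0 ∧
            (fderiv ℝ (v' z.1) z.2 (EuclideanSpace.single 0 1) 2 ≠ 0 ∨ fderiv ℝ (v' z.1) z.2 (EuclideanSpace.single 1 1) 2 ≠ 0) ∧
            (fderiv ℝ (v' z.1) z.2 (EuclideanSpace.single 2 1) 0 ≠ 0 ∨ fderiv ℝ (v' z.1) z.2 (EuclideanSpace.single 2 1) 1 ≠ 0)) →
        (∃ s : ℝ, s < 0 ∧ ∃ U : Set (EuclideanSpace ℝ (Fin 3)), IsOpen U ∧ U.Nonempty ∧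
          ((∃ e : EuclideanSpace ℝ (Fin 3), e ≠ 0 ∧
              ∀ y ∈ U, fderiv ℝ (Literature.Analysis.FluidPDE.curl (v' s)) y e = 0) ∨
           (∃ c : EuclideanSpace ℝ (Fin 3), ∀ y ∈ U,
              Literature.Analysis.FluidPDE.rotGen (Literature.Analysis.FluidPDE.curl (v' s) y) =
                fderiv ℝ (Literature.Analysis.FluidPDE.curl (v' s)) y (Literature.Analysis.FluidPDE.rotGen (y - c))) ∨
           (∃ w : EuclideanSpace ℝ (Fin 3) → EuclideanSpace ℝ (Fin 3), AnalyticOnNhd ℝ w Set.univ ∧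
              ¬ BddAbove (Set.range fun y => ‖w y‖) ∧ ∀ y ∈ U, v' s y = w y))) → False := by
      intro W hWne hWs hnd hgerm
      obtain ⟨z₀, hz₀⟩ := hWne
      obtain ⟨s, hs', U, hU, hUne, hg⟩ := hgerm
      exact false_of_germ_of_nondegenerate hrate' hcont' hmild' hdiv' hpol' (Set.mem_prod.1 (hWs hz₀)).1 (hnd z₀ hz₀).1
        hs' hU hUne hg
    have hpin := threadPin_of_hotSpot hrate' hcont' hmild' hhot
    have hsp := threadSignedPin C v' hrate' hcont' hmild' hdiv' hne hhot
    -- MORSE BRANCH: the thread is the axis (S4) ⇒ irrotational germ ⇒ `v' ≡ 0` (tree)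
    by_cases hM : ∀ e : EuclideanSpace ℝ (Fin 3), e ≠ 0 → e 2 = 0 →
        fderiv ℝ (fun x => fderiv ℝ (fun y => v' (-1) y 2) x e) 0 e ≠ 0
    · obtain ⟨U, hU, hUne, hcurl⟩ := threadAxis_of_NPV hNPV C v' hrate' hcont' hmild' hdiv' hpol' hne hhot hpin hsp hM
      exact habs (eq_zero_of_curl_eq_zero_on_open hrate' hcont' hmild' hdiv' hs hU hUne hcurl)
    -- NON-MORSE RESIDUE: far_thread's point dichotomy at the hot spot
    push Not at hM
    obtain ⟨e, he, he2, hflat⟩ := hM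
    rcases stub_threadDichotomy C v' hrate' hcont' hmild' hdiv' hpol' ((-1 : ℝ), (0 : EuclideanSpace ℝ (Fin 3))) hs with
      ⟨W, hW, hWs, hndtw, hthick, hacc⟩ | ⟨W, hW, hWne, hWs, hnd, htw0⟩ | ⟨W, hW, hWne, hWs, hnd, hpin, htw, hTH⟩ |
      ⟨W, hW, hWne, hWs, m, hm⟩ | ⟨s, hs', U, hU, hUne, hdeg⟩
    · -- (i) threaded thick: THIS LINE's stub
      exact stub_threadedThickEmptyFlat C v' hrate' hcont' hmild' hdiv' hpol' hne hhot hpin hsp ⟨e, he, he2, hflat⟩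
        W hW hWs hndtw hthick hacc
    · -- (ii) untwisted non-degenerate window: tree `stub_untwistedGerm`
      exact hgermAbs W hWne hWs hnd (stub_untwistedGerm C v' hrate' hcont' hmild' hdiv' hpol' W hW hWne hWs hnd htw0)
    · -- (iii) (TH) ∩ twisting: shared stub through the tree chain
      exact hgermAbs W hWne hWs hnd (twistingTH_germ C v' hrate' hcont' hmild' hdiv' hpol' W hW hWne hWs hnd hpin htw hTH)
    · -- (iv) time-only slope: (TV) is empty in Liouville currency
      exact habs (eq_zero_of_local_timeOnlySlope hrate' hcont' hmild' hdiv' hpol' hW hWne hWs hm)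
    · -- (v) a degenerate open germ on one slice
      rcases hdeg with hcurl | hflat | hrig
      · exact habs (eq_zero_of_curl_eq_zero_on_open hrate' hcont' hmild' hdiv' hs' hU hUne hcurl)
      · exact habs (eq_zero_of_horizontalGradient_eq_zero_on_open hrate' hcont' hmild' hdiv' hs' (hpol' s hs') hU hUne
          fun y hy => (hflat y hy).1)
      · exact habs (eq_zero_of_verticalShear_eq_zero_on_open hrate' hcont' hmild' hdiv' hs' hU hUne hrig)

/-! ## Composition, step 4 (proved): the cruxes BY NAME -/

/-- The slice-sharp residue shape of `…Sharper.poloidalWindowRigidity_of_sliceSharpNonflatLiouville` (all genericity hypotheses unused). -/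
theorem sliceSharpNonflatLiouville_of_threadAxis
    (hNPV :
      ∀ (C : ℝ) (v : ℝ → EuclideanSpace ℝ (Fin 3) → EuclideanSpace ℝ (Fin 3)),
      Literature.Analysis.FluidPDE.HasTypeITimeDecay C v →
      ContinuousOn (Function.uncurry v) (Set.Iio (0 : ℝ) ×ˢ Set.univ) →
      (∀ s t : ℝ, s < t → t < 0 → ∀ x, v t x =
        Literature.Analysis.UnboundedOperators.heatExtension (v s) (t - s) x -
          Literature.Analysis.FluidPDE.oseenDuhamel 1 s v v t x) →
      (∀ t < 0, Literature.Analysis.FluidPDE.VectorCalculus.IsDivFree (v t)) →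
      (∀ s < 0, ∀ y, ⟪Literature.Analysis.FluidPDE.curl (v s) y, EuclideanSpace.single 2 1⟫_ℝ = 0) →
      ∀ t < 0, ∀ (c : ℝ → EuclideanSpace ℝ (Fin 3)) (T : ℝ), 0 < T → Function.Periodic c T →
        (∀ s, HasDerivAt c (Literature.Analysis.FluidPDE.curl (v t) (c s)) s) →
        ∀ s, Literature.Analysis.FluidPDE.curl (v t) (c s) = 0) :
    ∀ (C : ℝ) (v : ℝ → EuclideanSpace ℝ (Fin 3) → EuclideanSpace ℝ (Fin 3)),
      Literature.Analysis.FluidPDE.HasTypeITimeDecay C v →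
      ContinuousOn (Function.uncurry v) (Set.Iio (0 : ℝ) ×ˢ Set.univ) →
      (∀ s t : ℝ, s < t → t < 0 → ∀ x, v t x =
        Literature.Analysis.UnboundedOperators.heatExtension (v s) (t - s) x -
          Literature.Analysis.FluidPDE.oseenDuhamel 1 s v v t x) →
      (∀ t < 0, Literature.Analysis.FluidPDE.VectorCalculus.IsDivFree (v t)) →
      (∀ s < 0, ∀ y, ⟪Literature.Analysis.FluidPDE.curl (v s) y, EuclideanSpace.single 2 1⟫_ℝ = 0) →
      (∀ s < 0, ∀ y, ⟪fderiv ℝ (v s) y (Literature.Analysis.FluidPDE.curl (v s) y), EuclideanSpace.single 2 1⟫_ℝ = 0) →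
      (∀ s < 0, ∀ b : EuclideanSpace ℝ (Fin 3), b ≠ 0 → ∃ y,
        Literature.Analysis.FluidPDE.cross (Literature.Analysis.FluidPDE.curl (v s) y) b ≠ 0) →
      (∀ s < 0, ∃ y, fderiv ℝ (v s) y (EuclideanSpace.single 2 1) 0 ≠ 0 ∨
        fderiv ℝ (v s) y (EuclideanSpace.single 2 1) 1 ≠ 0) →
      (∀ s < 0, ∀ a : EuclideanSpace ℝ (Fin 3), a ≠ 0 → ⟪a, EuclideanSpace.single 2 1⟫_ℝ = 0 →
        ∃ y, ⟪fderiv ℝ (v s) y a, EuclideanSpace.single 2 1⟫_ℝ ≠ 0) →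
      (∀ s < 0, ∀ e : EuclideanSpace ℝ (Fin 3), e ≠ 0 → ∃ (y : EuclideanSpace ℝ (Fin 3)) (l : ℝ), v s (y + l • e) ≠ v s y) →
      (∀ s < 0, ∀ (L : EuclideanSpace ℝ (Fin 3) ≃ₗᵢ[ℝ] EuclideanSpace ℝ (Fin 3)) (c : EuclideanSpace ℝ (Fin 3)),
        ¬ Literature.Analysis.FluidPDE.IsAxisymmetric (fun y => L.symm (v s (L y + c)))) →
      (∃ lam : ℝ, 0 < lam ∧ ∃ s < 0, ∃ y, lam • v (lam ^ 2 * s) (lam • y) ≠ v s y) →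
        ¬ Literature.Analysis.FluidPDE.IsBackwardSingularPoint v 0 := by
  intro C v hrate hcont hmild hdiv hpol _ _ _ _ _ _ _
  exact not_backwardSingular_of_zero (poloidalLiouville_of_threadAxis hNPV C v hrate hcont hmild hdiv hpol)

/-- **COMPOSITION (proved): the crux `PoloidalWindowRigidity` (stmt-NavierStokesRegularity-19708) BY NAME** from `stub_extremalThread` (S1, provable,
shared), `stub_frequencyGrowthExponent` (S6G, deciding, v5; ≤ `LoopPeriodRatchet.PeriodRatchet` by `frequencyGrowthExponent_of_periodRatchet`) with `morseLevelPackage_landed` (S7′-M, provable pure calculus; v10: S7′-S `slavedOnLevelCircle` PROVED; S7′ `planarFirstIntegralGerm` and S7 `threadGermOfNPV` proved from them and the tree) and — on the non-Morse residue only — `stub_threadDichotomy` (S2, provable, shared),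
`stub_threadedThickEmptyFlat` (S3′, far_thread's S3 weakened) and the shared `stub_localTHEmptyHypNUGRS` ((TH) column, `twist_split` v4.3), via the
landed reduction `…Sharper.poloidalWindowRigidity_of_sliceSharpNonflatLiouville`. -/
theorem PoloidalWindowRigidity_of_threadAxis :
    Summit.NavierStokesRegularity.NavierStokesRegularity.Theses.PoloidalWindowDoor.PoloidalWindowRigidity :=
  poloidalWindowRigidity_of_sliceSharpNonflatLiouville (sliceSharpNonflatLiouville_of_threadAxis noPeriodicVortexLine)

/-- **COMPOSITION (proved): the promoted stub `LrcModEntire` (stmt-NavierStokesRegularity-20428) BY NAME** — a poloidal class profile is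
`≡ 0`, so a non-degenerate window is absurd. -/
theorem LrcModEntire_of_NPV
    (hNPV :
      ∀ (C : ℝ) (v : ℝ → EuclideanSpace ℝ (Fin 3) → EuclideanSpace ℝ (Fin 3)),
      Literature.Analysis.FluidPDE.HasTypeITimeDecay C v →
      ContinuousOn (Function.uncurry v) (Set.Iio (0 : ℝ) ×ˢ Set.univ) →
      (∀ s t : ℝ, s < t → t < 0 → ∀ x, v t x =
        Literature.Analysis.UnboundedOperators.heatExtension (v s) (t - s) x -
          Literature.Analysis.FluidPDE.oseenDuhamel 1 s v v t x) →
      (∀ t < 0, Literature.Analysis.FluidPDE.VectorCalculus.IsDivFree (v t)) →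
      (∀ s < 0, ∀ y, ⟪Literature.Analysis.FluidPDE.curl (v s) y, EuclideanSpace.single 2 1⟫_ℝ = 0) →
      ∀ t < 0, ∀ (c : ℝ → EuclideanSpace ℝ (Fin 3)) (T : ℝ), 0 < T → Function.Periodic c T →
        (∀ s, HasDerivAt c (Literature.Analysis.FluidPDE.curl (v t) (c s)) s) →
        ∀ s, Literature.Analysis.FluidPDE.curl (v t) (c s) = 0) :
    Summit.NavierStokesRegularity.NavierStokesRegularity.Theses.PoloidalWindowDoor.LrcModEntire := by
  intro C v hrate hcont hmild hdiv hpol W hW hWne hWs hnd hpin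
  exfalso
  obtain ⟨z₀, hz₀⟩ := hWne
  have hzero := poloidalLiouville_of_threadAxis hNPV C v hrate hcont hmild hdiv hpol
  apply (hnd z₀ hz₀).1
  have hfun : v z₀.1 = fun _ => 0 := funext fun x => hzero z₀.1 (Set.mem_prod.1 (hWs hz₀)).1 x
  rw [hfun]
  simp [Literature.Analysis.FluidPDE.curl]

/-- **COMPOSITION (proved): `LrcModEntire` (stmt-NavierStokesRegularity-20428) BY NAME, on this line's own stubs.** -/
theorem LrcModEntire_of_threadAxis :
    Summit.NavierStokesRegularity.NavierStokesRegularity.Theses.PoloidalWindowDoor.LrcModEntire :=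
  LrcModEntire_of_NPV noPeriodicVortexLine

/-- **CROSS-ROUTE COMPOSITION (v7, kernel-checked): `LoopPeriodRatchet.PeriodRatchet` + this line's stubs S0, S1, S2, S3′, S7 ⇒ the crux
`PoloidalWindowRigidity`** — i.e. the other route's deciding crux can stand in for S6G, and this line's thread normal-form chain can stand in for
their open `PlanarExtremumLiouville` on the way to rung N0 (no claim about which is easier; recorded for the director). -/
theorem PoloidalWindowRigidity_of_periodRatchet
    (hR : Summit.NavierStokesRegularity.NavierStokesRegularity.Theses.LoopPeriodRatchet.PeriodRatchet) :
    Summit.NavierStokesRegularity.NavierStokesRegularity.Theses.PoloidalWindowDoor.PoloidalWindowRigidity :=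
  poloidalWindowRigidity_of_sliceSharpNonflatLiouville
    (sliceSharpNonflatLiouville_of_threadAxis (noPeriodicVortexLine_of_periodRatchet hR))

/-- **CROSS-ROUTE COMPOSITION (v7): `PeriodRatchet` + stubs S0, S1, S2, S3′, S7 ⇒ `LrcModEntire`.** -/
theorem LrcModEntire_of_periodRatchet
    (hR : Summit.NavierStokesRegularity.NavierStokesRegularity.Theses.LoopPeriodRatchet.PeriodRatchet) :
    Summit.NavierStokesRegularity.NavierStokesRegularity.Theses.PoloidalWindowDoor.LrcModEntire :=
  LrcModEntire_of_NPV (noPeriodicVortexLine_of_periodRatchet hR)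

end Summit.NavierStokesRegularity.NavierStokesRegularity.Cruxes.PoloidalWindowRigidity.ThreadAxis
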